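/-
Copyright (c) 2026 the pub-hodgecm-mathlib formalisation cell (harness21).  Prover seat hodgecm-mathlib-F0P3a-p01 (g16): road «S3-ram» (LEAD F0P3a-plan (g12); architect
A-p16 (g31) 22:49:18Z «(a2) SHELL SUMS → p01», 23:19:27Z G1–G7 deals), organ A′ (ii) (a2), gap G5 «THE INDUCTION PROPER» of BLUEPRINT-a2B v1; 2026-09-01.
-/
import Mathlib
import Literature.Combinatorics.SimpleGraph.TreeDescendantPartition                    -- ★ G1 (F0P2-p02 (g13)): `ncard_setOf_dist_inter_eq_add_finsum_finsum_of_parentClosed`, `disjoint_setOf_dist_of_ne`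
import Literature.NumberTheory.Rogawski1990.DepthZeroKappaTransferTypeOneRamifiedShellSums   -- ★ (a2)(A) (this seat, p847094 ∕ ED. 2 p847162): the closed forms `shellSum_*`
import HarnessLib

/-!
# The ramified type-(1) `κ`-orbital integral: the TREE INDUCTION — from the local branching law of the fixed labelled tree to the strata totals of every descendant cone
# (Kottwitz 1986 §3; Rogawski 1990 §4.9; Serre, *Trees* I.2.3, II.1.1)

Topic `NumberTheory/Rogawski1990`; namespace `Literature.NumberTheory.Rogawski1990`.  THEOREMS ONLY (no definition, no instance, no notation, no named fact, no `sorry`); kernel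
lane `--supports stmt-HodgeConjecture-24833`; Mathlib + ★ `TreeDescendantPartition` (G1) only — a GENERIC rooted-tree engine (any `SimpleGraph`, any vertex type).  Cell
`pub/hodgecm-mathlib` (D-0151), crux H413; road «S3-ram» (Literature seeding, count-neutral), P-1-ram organ A′ (ii) (a2) «SHELL SUMS», gap **G5 (B6) «THE INDUCTION PROPER»** of
`F0/P3a/F0P3a-p01/g16/rootbook/BLUEPRINT-a2B-TreeInduction.v1…md` §2: it turns the LOCAL BRANCHING LAW of the fixed labelled subtree of a ramified type-(1) literal (G3 «inward
line null ∕ outward multiplicities», F0P2-p06 (g12); G2 «rank of the drop-1 child», F0P2-p01 (g15); the class law ★ `UnitaryLatticeTreeFixedChildClassRamified`) into the STRATA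
TOTALS of every descendant cone, i.e. into the per-label vectors `S(ℓ)` whose closed forms are ★ `DepthZeroKappaTransferTypeOneRamifiedShellSums` (`shellSum_*`).  Everything
specific to lattices is abstracted into HYPOTHESES, so the file is sorry-free today and the junction (A-p16 (g31)) discharges the hypotheses by the ★ local-law files.

THE ABSTRACT SETTING.  `G` a tree (the bipartite lattice tree), root `r` (= `L₀`), a finite set `F` of vertices, parent-closed towards `r` (= the fixed vertices of the literal, ★
`parentClosed_fixedPoints`), a predicate `SD` (= self-dual) alternating along edges, and on vertices three label coordinates `dep : V → ℕ` (depth `d_M`), `rk : V → ℕ` (rank of the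
leading matrix), `cl : V → ℤ` (the class `±1` of a rank-one vertex); the cone `Desc v = {w | dist r w = dist r v + dist v w}` and the fixed GRANDCHILDREN
`GC v = {w | ∃ c, (v ~ c, dist r c = dist r v + 1, c ∈ F) ∧ (c ~ w, dist r w = dist r c + 1, w ∈ F)}` are taken as set-valued binders with their membership characterisations
(`hDesc`, `hGC`) so that statements stay short and instantiation is `Iff.rfl`.  The five STRATA `str j` (`j : Fin 5`, order (bd, reg, 1⁺, 1⁻, 0) of ★ ShellSums) are a binder
characterised on labels by `hstr`: `str 0 ↔ dep = 0`, `str 1 ↔ dep = 1 ∧ rk = 2`, `str 2 ↔ dep = 1 ∧ rk = 1 ∧ cl = 1`, `str 3 ↔ dep = 1 ∧ rk = 1 ∧ cl = −1`, `str 4 ↔ 2 ≤ dep`.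
THE LOCAL LAW (hypotheses, for `v ∈ F`, `SD v`, `v ≠ r`; labels `E_m = (2m, 2)` (`m ≥ 1`), `O_m = (2m+1, 2)`, `P^c_m = (2m+1, 1, c)`, `B = (0, ·)`; `q` the residue cardinality,
`s = χ(−1) ∈ {±1}` the class flip of ★ `UnitaryLatticeTreeFixedChildClassRamified`):  `E_{m+1}`: `q²` fixed grandchildren, all `O_m`;  `O_{m+1}`: `q` of label `E_{m+1}`, `C(q,2)`
of label `P⁺_m`, `C(q,2)` of label `P⁻_m`, nothing else;  `P^c_{m+1}`: `q²`, all `P^{sc}_m`;  `O_0 = R`: `q`, all of depth `0`;  `P^c_0 = C^c` and `B`: none.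
THE CONCLUSION (`strataVec_cone_eq_of_localLaw`): for every such `v`, the vector `j ↦ #(Desc v ∩ F ∩ {SD ∧ str j})` equals `T(label v)` for ANY family `T` obeying the shell
recursion `T(E_{m+1}) = e₄ + q²T(O_m)`, `T(O_0) = e₁ + q e₀`, `T(O_{m+1}) = e₄ + qT(E_{m+1}) + C(q,2)(T(P⁺_m) + T(P⁻_m))`, `T(P^{±}_0) = e₂ ∕ e₃`, `T(P^c_{m+1}) = e₄ + q²T(P^{sc}_m)`,
`T(B) = e₀` — the ★ closed forms are one such family (`shellSum_E_succ`, `shellSum_O_zero`, `shellSum_O_succ{,_keep}`, `shellSum_P_{pos,neg}_succ` ∕ `shellSum_P_keep_*`).  Proof: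
strong induction on `dep v`; one step = ★ G1's grandchildren recursion (children of a self-dual vertex are modular, so the middle layer contributes nothing), the double `finsum`
collapsed to a sum over `GC v` (distinct children have disjoint cones, ★ `disjoint_setOf_dist_of_ne`), the summands evaluated by the induction hypothesis and regrouped by label.
HONEST LABEL: HC_CM is proved only modulo the 2 remaining named inputs (hLiu418 24832, h413 24833) until rung 0 closes; nothing printed is asserted here (rooted-tree bookkeeping).

## References
* [Kottwitz1986] R. E. Kottwitz, *Base change for unit elements of Hecke algebras*, Compositio Math. 60 (1986), §3 (counting fixed lattices shell by shell).
* [Rogawski1990] J. D. Rogawski, *Automorphic Representations of Unitary Groups in Three Variables*, Ann. of Math. Stud. 123 (1990), §4.9 pp. 54–56 (the strata of the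
  ramified orbital integrals).
* [Serre1980Trees] J.-P. Serre, *Trees* (1980), I.2.3 (projection onto a subtree; cones), II.1.1 (the tree of lattices).
-/

set_option autoImplicit false

open Finset SimpleGraph
open Literature.Combinatorics.SimpleGraph.TreeLayers

namespace Literature.NumberTheory.Rogawski1990

variable {V : Type*} {G : SimpleGraph V}

/-! ## §1 One step: the strata vector of a cone = its apex + the sum over the fixed grandchildren -/

/-- In a tree, the `F`-children of two distinct vertices at the same distance from the root are disjoint (each lies in its parent's cone, ★ `disjoint_setOf_dist_of_ne`).
[cite: Serre1980Trees, I.2.3] -/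
theorem disjoint_children_of_ne (hT : G.IsTree) (r : V) (F : Set V) {c c' : V} (hcc : G.dist r c = G.dist r c') (hne : c ≠ c') :
    Disjoint ({d | G.Adj c d ∧ G.dist r d = G.dist r c + 1} ∩ F) ({d | G.Adj c' d ∧ G.dist r d = G.dist r c' + 1} ∩ F) := by
  refine (disjoint_setOf_dist_of_ne hT r hcc hne).mono ?_ ?_
  · rintro d ⟨⟨hadj, hd⟩, -⟩
    show G.dist r d = G.dist r c + G.dist c d
    rw [hd, dist_eq_one_iff_adj.2 hadj]
  · rintro d ⟨⟨hadj, hd⟩, -⟩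
    show G.dist r d = G.dist r c' + G.dist c' d
    rw [hd, dist_eq_one_iff_adj.2 hadj]

/-- **ONE STEP (vector form).**  For a vertex `v` whose children all fail `SD` (a self-dual vertex of the bipartite lattice tree), the strata vector of its cone is its own
indicator plus the sum of the strata vectors of the cones of its fixed grandchildren `GC v` (★ G1 two-step recursion, the double `finsum` collapsed along the disjoint children).
[cite: Serre1980Trees, I.2.3] [cite: Kottwitz1986, §3] -/
theorem strataVec_cone_eq_indicator_add_sum (hT : G.IsTree) (r v : V) (F : Set V) (hFfin : F.Finite)
    (hF : ∀ w ∈ F, w ≠ r → ∀ u, G.Adj w u → G.dist r u + 1 = G.dist r w → u ∈ F) (SD : V → Prop) (str : Fin 5 → V → Prop)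
    [DecidablePred (· ∈ F)] [DecidablePred SD] [∀ j, DecidablePred (str j)]
    (hSDc : ∀ c, G.Adj v c → G.dist r c = G.dist r v + 1 → ¬ SD c)
    (GC : Set V) (hGC : ∀ w, w ∈ GC ↔ ∃ c, (G.Adj v c ∧ G.dist r c = G.dist r v + 1 ∧ c ∈ F) ∧ (G.Adj c w ∧ G.dist r w = G.dist r c + 1 ∧ w ∈ F))
    (s : Finset V) (hs : ∀ w, w ∈ s ↔ w ∈ GC) :
    (fun j => ({w | G.dist r w = G.dist r v + G.dist v w} ∩ F ∩ {w | SD w ∧ str j w}).ncard) =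
      (fun j => if v ∈ F ∧ (SD v ∧ str j v) then 1 else 0) +
        ∑ w ∈ s, (fun j => ({u | G.dist r u = G.dist r w + G.dist w u} ∩ F ∩ {u | SD u ∧ str j u}).ncard) := by
  funext j
  rw [Pi.add_apply, Finset.sum_apply,
    ncard_setOf_dist_inter_eq_add_finsum_finsum_of_parentClosed hT r v F hFfin hF (fun w => SD w ∧ str j w) (fun c hadj hdc hP => hSDc c hadj hdc hP.1)]
  congr 1
  have hA : ({c | G.Adj v c ∧ G.dist r c = G.dist r v + 1} ∩ F).Finite := hFfin.subset Set.inter_subset_right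
  have hB : ∀ c ∈ {c | G.Adj v c ∧ G.dist r c = G.dist r v + 1} ∩ F, ({d | G.Adj c d ∧ G.dist r d = G.dist r c + 1} ∩ F).Finite :=
    fun c _ => hFfin.subset Set.inter_subset_right
  have hdisj : ({c | G.Adj v c ∧ G.dist r c = G.dist r v + 1} ∩ F).PairwiseDisjoint (fun c => {d | G.Adj c d ∧ G.dist r d = G.dist r c + 1} ∩ F) := by
    rintro c ⟨⟨-, hc⟩, -⟩ c' ⟨⟨-, hc'⟩, -⟩ hne
    exact disjoint_children_of_ne hT r F (hc.trans hc'.symm) hne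
  rw [← finsum_mem_biUnion hdisj hA hB]
  have hU : (⋃ c ∈ ({c | G.Adj v c ∧ G.dist r c = G.dist r v + 1} ∩ F), ({d | G.Adj c d ∧ G.dist r d = G.dist r c + 1} ∩ F)) = (s : Set V) := by
    ext w
    simp only [Set.mem_iUnion, Set.mem_inter_iff, Set.mem_setOf_eq, Finset.mem_coe, hs, hGC, exists_prop]
    constructor
    · rintro ⟨c, ⟨⟨h1, h2⟩, h3⟩, ⟨h4, h5⟩, h6⟩; exact ⟨c, ⟨h1, h2, h3⟩, h4, h5, h6⟩
    · rintro ⟨c, ⟨h1, h2, h3⟩, h4, h5, h6⟩; exact ⟨c, ⟨⟨h1, h2⟩, h3⟩, ⟨h4, h5⟩, h6⟩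
  rw [hU, finsum_mem_coe_finset]


/-! ## §2 The indicator of the apex, by label -/

/-- The apex indicator `j ↦ [v ∈ F ∧ SD v ∧ str j v]` of a labelled fixed self-dual vertex is the basis vector of its stratum. [cite: Rogawski1990, §4.9 p. 55] -/
theorem strataIndicator_eq_of_label {F : Set V} {SD : V → Prop} {str : Fin 5 → V → Prop}
    [DecidablePred (· ∈ F)] [DecidablePred SD] [∀ j, DecidablePred (str j)] {dep rk : V → ℕ} {cl : V → ℤ} {v : V} (hv : v ∈ F) (hvS : SD v)
    (hstr : (str 0 v ↔ dep v = 0) ∧ (str 1 v ↔ dep v = 1 ∧ rk v = 2) ∧ (str 2 v ↔ dep v = 1 ∧ rk v = 1 ∧ cl v = 1) ∧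
      (str 3 v ↔ dep v = 1 ∧ rk v = 1 ∧ cl v = -1) ∧ (str 4 v ↔ 2 ≤ dep v)) :
    (dep v = 0 → (fun j => if v ∈ F ∧ (SD v ∧ str j v) then 1 else 0) = (![1, 0, 0, 0, 0] : Fin 5 → ℕ)) ∧
    (dep v = 1 → rk v = 2 → (fun j => if v ∈ F ∧ (SD v ∧ str j v) then 1 else 0) = (![0, 1, 0, 0, 0] : Fin 5 → ℕ)) ∧
    (dep v = 1 → rk v = 1 → cl v = 1 → (fun j => if v ∈ F ∧ (SD v ∧ str j v) then 1 else 0) = (![0, 0, 1, 0, 0] : Fin 5 → ℕ)) ∧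
    (dep v = 1 → rk v = 1 → cl v = -1 → (fun j => if v ∈ F ∧ (SD v ∧ str j v) then 1 else 0) = (![0, 0, 0, 1, 0] : Fin 5 → ℕ)) ∧
    (2 ≤ dep v → (fun j => if v ∈ F ∧ (SD v ∧ str j v) then 1 else 0) = (![0, 0, 0, 0, 1] : Fin 5 → ℕ)) := by
  obtain ⟨h0, h1, h2, h3, h4⟩ := hstr
  refine ⟨fun hd => ?_, fun hd hr => ?_, fun hd hr hc => ?_, fun hd hr hc => ?_, fun hd => ?_⟩
  · funext j; fin_cases j <;> simp [hv, hvS, h0, h1, h2, h3, h4, hd]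
  · funext j; fin_cases j <;> simp [hv, hvS, h0, h1, h2, h3, h4, hd, hr]
  · funext j; fin_cases j <;> simp [hv, hvS, h0, h1, h2, h3, h4, hd, hr, hc]
  · funext j; fin_cases j <;> simp [hv, hvS, h0, h1, h2, h3, h4, hd, hr, hc]
  · funext j; fin_cases j <;> simp [hv, hvS, h0, h1, h2, h3, h4, hd, show dep v ≠ 0 by omega, show dep v ≠ 1 by omega]

/-! ## §3 The induction: local branching law ⇒ strata vector of every cone -/

/-- **THE TREE INDUCTION (G5 of the (a2) blueprint).**  In a rooted tree with a finite parent-closed vertex set `F` (fixed vertices), an alternating predicate `SD` (self-dual),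
labels `(dep, rk, cl)` and strata `str` as in the module docstring, the LOCAL BRANCHING LAW of the fixed grandchildren (`hB`, `hC`, `hR`, `hE`, `hO`, `hP`, with residue
cardinality `q` and class flip `s = ±1`) implies: the strata vector of the cone of every fixed self-dual non-root vertex `v` is `T(label v)` for ANY family `(TE, TO, TP)` obeying
the shell recursion (`hTE`, `hTO0`, `hTOs`, `hTP0`, `hTP0'`, `hTPs`) — in particular for the ★ closed forms of `DepthZeroKappaTransferTypeOneRamifiedShellSums`.
[cite: Kottwitz1986, §3] [cite: Rogawski1990, §4.9 pp. 54–56] [cite: Serre1980Trees, I.2.3] -/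
theorem strataVec_cone_eq_of_localLaw (hT : G.IsTree) (r : V) (F : Set V) (hFfin : F.Finite)
    (hF : ∀ w ∈ F, w ≠ r → ∀ u, G.Adj w u → G.dist r u + 1 = G.dist r w → u ∈ F) (SD : V → Prop) (str : Fin 5 → V → Prop)
    [DecidablePred (· ∈ F)] [DecidablePred SD] [∀ j, DecidablePred (str j)]
    (hSD₁ : ∀ v c, G.Adj v c → SD v → ¬ SD c) (hSD₂ : ∀ c w, G.Adj c w → ¬ SD c → SD w)
    (dep rk : V → ℕ) (cl : V → ℤ)
    (hstr : ∀ w ∈ F, SD w → (str 0 w ↔ dep w = 0) ∧ (str 1 w ↔ dep w = 1 ∧ rk w = 2) ∧ (str 2 w ↔ dep w = 1 ∧ rk w = 1 ∧ cl w = 1) ∧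
      (str 3 w ↔ dep w = 1 ∧ rk w = 1 ∧ cl w = -1) ∧ (str 4 w ↔ 2 ≤ dep w))
    (GC : V → Set V)
    (hGC : ∀ v w, w ∈ GC v ↔ ∃ c, (G.Adj v c ∧ G.dist r c = G.dist r v + 1 ∧ c ∈ F) ∧ (G.Adj c w ∧ G.dist r w = G.dist r c + 1 ∧ w ∈ F))
    (q : ℕ) (s : ℤ)
    (hrk : ∀ v ∈ F, SD v → v ≠ r → 1 ≤ dep v → rk v = 1 ∨ rk v = 2)
    (hcl : ∀ v ∈ F, SD v → v ≠ r → rk v = 1 → cl v = 1 ∨ cl v = -1)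
    (hodd : ∀ v ∈ F, SD v → v ≠ r → 2 ≤ dep v → rk v = 1 → Odd (dep v))
    (hB : ∀ v ∈ F, SD v → v ≠ r → dep v = 0 → GC v = ∅)
    (hC : ∀ v ∈ F, SD v → v ≠ r → dep v = 1 → rk v = 1 → GC v = ∅)
    (hR : ∀ v ∈ F, SD v → v ≠ r → dep v = 1 → rk v = 2 → (∀ w ∈ GC v, dep w = 0) ∧ (GC v).ncard = q)
    (hE : ∀ v ∈ F, SD v → v ≠ r → ∀ m, dep v = 2 * m + 2 → rk v = 2 → (∀ w ∈ GC v, dep w = 2 * m + 1 ∧ rk w = 2) ∧ (GC v).ncard = q ^ 2)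
    (hO : ∀ v ∈ F, SD v → v ≠ r → ∀ m, dep v = 2 * m + 3 → rk v = 2 →
      (∀ w ∈ GC v, (dep w = 2 * m + 2 ∧ rk w = 2) ∨ (dep w = 2 * m + 1 ∧ rk w = 1 ∧ (cl w = 1 ∨ cl w = -1))) ∧
        {w | w ∈ GC v ∧ dep w = 2 * m + 2}.ncard = q ∧ {w | w ∈ GC v ∧ dep w = 2 * m + 1 ∧ cl w = 1}.ncard = q.choose 2 ∧
          {w | w ∈ GC v ∧ dep w = 2 * m + 1 ∧ cl w = -1}.ncard = q.choose 2)
    (hP : ∀ v ∈ F, SD v → v ≠ r → ∀ m (c : ℤ), dep v = 2 * m + 3 → rk v = 1 → cl v = c →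
      (∀ w ∈ GC v, dep w = 2 * m + 1 ∧ rk w = 1 ∧ cl w = s * c) ∧ (GC v).ncard = q ^ 2)
    (TE TO : ℕ → Fin 5 → ℕ) (TP : ℤ → ℕ → Fin 5 → ℕ)
    (hTE : ∀ m, TE (m + 1) = ![0, 0, 0, 0, 1] + q ^ 2 • TO m)
    (hTO0 : TO 0 = ![0, 1, 0, 0, 0] + q • ![1, 0, 0, 0, 0])
    (hTOs : ∀ m, TO (m + 1) = ![0, 0, 0, 0, 1] + q • TE (m + 1) + q.choose 2 • (TP 1 m + TP (-1) m))
    (hTP0 : TP 1 0 = ![0, 0, 1, 0, 0]) (hTP0' : TP (-1) 0 = ![0, 0, 0, 1, 0])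
    (hTPs : ∀ m (c : ℤ), c = 1 ∨ c = -1 → TP c (m + 1) = ![0, 0, 0, 0, 1] + q ^ 2 • TP (s * c) m)
    {v : V} (hv : v ∈ F) (hvS : SD v) (hvr : v ≠ r) :
    (fun j => ({w | G.dist r w = G.dist r v + G.dist v w} ∩ F ∩ {w | SD w ∧ str j w}).ncard) =
      if dep v = 0 then ![1, 0, 0, 0, 0]
      else if rk v = 2 then (if Even (dep v) then TE (dep v / 2) else TO (dep v / 2)) else TP (cl v) (dep v / 2) := by
  -- strong induction on the depth label
  suffices key : ∀ n (v : V), dep v = n → v ∈ F → SD v → v ≠ r →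
      (fun j => ({w | G.dist r w = G.dist r v + G.dist v w} ∩ F ∩ {w | SD w ∧ str j w}).ncard) =
        if dep v = 0 then ![1, 0, 0, 0, 0]
        else if rk v = 2 then (if Even (dep v) then TE (dep v / 2) else TO (dep v / 2)) else TP (cl v) (dep v / 2) from
    key _ v rfl hv hvS hvr
  intro n
  induction n using Nat.strong_induction_on with
  | _ n ih =>
  intro v hdv hv hvS hvr
  -- the fixed grandchildren: a finite subset of `F`, self-dual, off the root
  have hGCF : GC v ⊆ F := fun w hw => by
    obtain ⟨c, -, -, -, hwF⟩ := (hGC v w).1 hw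
    exact hwF
  have hGCmem : ∀ w ∈ GC v, w ∈ F ∧ SD w ∧ w ≠ r := by
    intro w hw
    obtain ⟨c, ⟨hvc, hdc, -⟩, hcw, hdw, hwF⟩ := (hGC v w).1 hw
    refine ⟨hwF, hSD₂ c w hcw (hSD₁ v c hvc hvS), ?_⟩
    rintro rfl
    rw [SimpleGraph.dist_self] at hdw
    omega
  have hfin : (GC v).Finite := hFfin.subset hGCF
  have hsF : ∀ w, w ∈ hfin.toFinset ↔ w ∈ GC v := fun w => Set.Finite.mem_toFinset _
  have step := strataVec_cone_eq_indicator_add_sum hT r v F hFfin hF SD str (fun c hadj _ => hSD₁ v c hadj hvS) (GC v) (hGC v) hfin.toFinset hsF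
  rw [step]
  have hind := strataIndicator_eq_of_label (F := F) (SD := SD) (str := str) (dep := dep) (rk := rk) (cl := cl) hv hvS (hstr v hv hvS)
  obtain ⟨hI0, hI1, hI2, hI3, hI4⟩ := hind
  -- the induction hypothesis at a grandchild, as a function of its label
  have ihw : ∀ w ∈ GC v, dep w < dep v →
      (fun j => ({u | G.dist r u = G.dist r w + G.dist w u} ∩ F ∩ {u | SD u ∧ str j u}).ncard) =
        if dep w = 0 then ![1, 0, 0, 0, 0]
        else if rk w = 2 then (if Even (dep w) then TE (dep w / 2) else TO (dep w / 2)) else TP (cl w) (dep w / 2) := by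
    intro w hw hlt
    obtain ⟨hwF, hwS, hwr⟩ := hGCmem w hw
    exact ih (dep w) (hdv ▸ hlt) w rfl hwF hwS hwr
  -- finset cardinalities of label classes inside `GC v`
  have hcardGC : hfin.toFinset.card = (GC v).ncard := (Set.ncard_eq_toFinset_card _ hfin).symm
  rcases Nat.eq_zero_or_pos (dep v) with hd0 | hdpos
  · -- label B: a leaf
    have hempty : hfin.toFinset = ∅ := by
      rw [Finset.eq_empty_iff_forall_notMem]
      intro w hw
      have := (hsF w).1 hw
      rw [hB v hv hvS hvr hd0] at this
      exact this
    rw [hI0 hd0, hempty, Finset.sum_empty, add_zero, if_pos hd0]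
  rcases hrk v hv hvS hvr hdpos with hr1 | hr2
  · -- rank one: `C^c` (depth 1) or `P^c_{m+1}` (depth `2m+3`)
    have hcv := hcl v hv hvS hvr hr1
    rcases Nat.lt_or_ge (dep v) 2 with hd1 | hd2
    · -- C^c: a leaf
      have hd : dep v = 1 := by omega
      have hempty : hfin.toFinset = ∅ := by
        rw [Finset.eq_empty_iff_forall_notMem]
        intro w hw
        have := (hsF w).1 hw
        rw [hC v hv hvS hvr hd hr1] at this
        exact this
      rw [hempty, Finset.sum_empty, add_zero, if_neg (by omega), if_neg (by omega), hd]
      rcases hcv with hc | hc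
      · rw [hI2 hd hr1 hc, hc, hTP0]
      · rw [hI3 hd hr1 hc, hc, hTP0']
    · -- P^c_{m+1}
      obtain ⟨m, hm⟩ : ∃ m, dep v = 2 * m + 3 := by
        obtain ⟨k, hk⟩ := hodd v hv hvS hvr hd2 hr1
        exact ⟨k - 1, by omega⟩
      obtain ⟨hlab, hcard⟩ := hP v hv hvS hvr m (cl v) hm hr1 rfl
      have hsum : ∑ w ∈ hfin.toFinset, (fun j => ({u | G.dist r u = G.dist r w + G.dist w u} ∩ F ∩ {u | SD u ∧ str j u}).ncard) =
          ∑ w ∈ hfin.toFinset, TP (s * cl v) m := by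
        refine Finset.sum_congr rfl (fun w hw => ?_)
        have hw := (hsF w).1 hw
        obtain ⟨hdw, hrw, hcw⟩ := hlab w hw
        rw [ihw w hw (by omega), if_neg (by omega), if_neg (by omega), hcw, hdw]
        congr 1
        omega
      rw [hI4 hd2, hsum, Finset.sum_const, hcardGC, hcard, if_neg (by omega), if_neg (by omega), hm,
        show (2 * m + 3) / 2 = m + 1 by omega, hTPs m (cl v) hcv]
  · -- rank two: `R` (depth 1), `E_{m+1}` (depth `2m+2`), `O_{m+1}` (depth `2m+3`)
    rcases Nat.lt_or_ge (dep v) 2 with hd1 | hd2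
    · -- R = O_0
      have hd : dep v = 1 := by omega
      obtain ⟨hlab, hcard⟩ := hR v hv hvS hvr hd hr2
      have hsum : ∑ w ∈ hfin.toFinset, (fun j => ({u | G.dist r u = G.dist r w + G.dist w u} ∩ F ∩ {u | SD u ∧ str j u}).ncard) =
          ∑ w ∈ hfin.toFinset, (![1, 0, 0, 0, 0] : Fin 5 → ℕ) := by
        refine Finset.sum_congr rfl (fun w hw => ?_)
        have hw := (hsF w).1 hw
        rw [ihw w hw (by rw [hlab w hw]; omega), if_pos (hlab w hw)]
      rw [hI1 hd hr2, hsum, Finset.sum_const, hcardGC, hcard, if_neg (by omega), if_pos hr2, if_neg (by rw [hd]; decide), hd,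
        show 1 / 2 = 0 from rfl, hTO0]
    · rcases Nat.even_or_odd (dep v) with heven | hodd'
      · -- E_{m+1}
        obtain ⟨m, hm⟩ : ∃ m, dep v = 2 * m + 2 := by
          obtain ⟨k, hk⟩ := heven
          exact ⟨k - 1, by omega⟩
        obtain ⟨hlab, hcard⟩ := hE v hv hvS hvr m hm hr2
        have hsum : ∑ w ∈ hfin.toFinset, (fun j => ({u | G.dist r u = G.dist r w + G.dist w u} ∩ F ∩ {u | SD u ∧ str j u}).ncard) =
            ∑ w ∈ hfin.toFinset, TO m := by
          refine Finset.sum_congr rfl (fun w hw => ?_)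
          have hw := (hsF w).1 hw
          obtain ⟨hdw, hrw⟩ := hlab w hw
          rw [ihw w hw (by omega), if_neg (by omega), if_pos hrw, if_neg (by rw [hdw, Nat.even_add_one, Nat.even_mul]; simp), hdw,
            show (2 * m + 1) / 2 = m by omega]
        rw [hI4 hd2, hsum, Finset.sum_const, hcardGC, hcard, if_neg (by omega), if_pos hr2, if_pos heven, hm,
          show (2 * m + 2) / 2 = m + 1 by omega, hTE]
      · -- O_{m+1}
        obtain ⟨m, hm⟩ : ∃ m, dep v = 2 * m + 3 := by
          obtain ⟨k, hk⟩ := hodd'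
          exact ⟨k - 1, by omega⟩
        obtain ⟨hlab, hcE, hcP, hcM⟩ := hO v hv hvS hvr m hm hr2
        -- split the grandchildren by label
        have hsplit := (Finset.sum_filter_add_sum_filter_not hfin.toFinset (fun w => dep w = 2 * m + 2)
          (fun w => (fun j => ({u | G.dist r u = G.dist r w + G.dist w u} ∩ F ∩ {u | SD u ∧ str j u}).ncard))).symm
        have hsplit' := (Finset.sum_filter_add_sum_filter_not (hfin.toFinset.filter (fun w => ¬ dep w = 2 * m + 2)) (fun w => cl w = 1)
          (fun w => (fun j => ({u | G.dist r u = G.dist r w + G.dist w u} ∩ F ∩ {u | SD u ∧ str j u}).ncard))).symm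
        -- values on the three classes
        have hvE : ∀ w ∈ hfin.toFinset.filter (fun w => dep w = 2 * m + 2),
            (fun j => ({u | G.dist r u = G.dist r w + G.dist w u} ∩ F ∩ {u | SD u ∧ str j u}).ncard) = TE (m + 1) := by
          intro w hw
          rw [Finset.mem_filter] at hw
          have hw' := (hsF w).1 hw.1
          have hrw : rk w = 2 := by
            rcases hlab w hw' with ⟨-, h⟩ | ⟨h, -⟩
            · exact h
            · omega
          rw [ihw w hw' (by omega), if_neg (by omega), if_pos hrw, if_pos (by rw [hw.2]; exact ⟨m + 1, by ring⟩), hw.2,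
            show (2 * m + 2) / 2 = m + 1 by omega]
        have hvP : ∀ w ∈ (hfin.toFinset.filter (fun w => ¬ dep w = 2 * m + 2)).filter (fun w => cl w = 1),
            (fun j => ({u | G.dist r u = G.dist r w + G.dist w u} ∩ F ∩ {u | SD u ∧ str j u}).ncard) = TP 1 m := by
          intro w hw
          rw [Finset.mem_filter, Finset.mem_filter] at hw
          have hw' := (hsF w).1 hw.1.1
          obtain ⟨hdw, hrw, -⟩ : dep w = 2 * m + 1 ∧ rk w = 1 ∧ (cl w = 1 ∨ cl w = -1) := by
            rcases hlab w hw' with ⟨h, -⟩ | h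
            · exact absurd h hw.1.2
            · exact h
          rw [ihw w hw' (by omega), if_neg (by omega), if_neg (by omega), hw.2, hdw, show (2 * m + 1) / 2 = m by omega]
        have hvM : ∀ w ∈ (hfin.toFinset.filter (fun w => ¬ dep w = 2 * m + 2)).filter (fun w => ¬ cl w = 1),
            (fun j => ({u | G.dist r u = G.dist r w + G.dist w u} ∩ F ∩ {u | SD u ∧ str j u}).ncard) = TP (-1) m := by
          intro w hw
          rw [Finset.mem_filter, Finset.mem_filter] at hw
          have hw' := (hsF w).1 hw.1.1
          obtain ⟨hdw, hrw, hcw⟩ : dep w = 2 * m + 1 ∧ rk w = 1 ∧ (cl w = 1 ∨ cl w = -1) := by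
            rcases hlab w hw' with ⟨h, -⟩ | h
            · exact absurd h hw.1.2
            · exact h
          have hc : cl w = -1 := hcw.resolve_left hw.2
          rw [ihw w hw' (by omega), if_neg (by omega), if_neg (by omega), hc, hdw, show (2 * m + 1) / 2 = m by omega]
        -- the three cardinalities
        have hcE' : (hfin.toFinset.filter (fun w => dep w = 2 * m + 2)).card = q := by
          have hset : {w | w ∈ GC v ∧ dep w = 2 * m + 2} = ↑(hfin.toFinset.filter (fun w => dep w = 2 * m + 2)) := by
            ext w
            simp only [Set.mem_setOf_eq, Finset.coe_filter, Set.Finite.mem_toFinset]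
          rw [← hcE, hset, Set.ncard_coe_finset]
        have hcP' : ((hfin.toFinset.filter (fun w => ¬ dep w = 2 * m + 2)).filter (fun w => cl w = 1)).card = q.choose 2 := by
          have hset : {w | w ∈ GC v ∧ dep w = 2 * m + 1 ∧ cl w = 1} = ↑((hfin.toFinset.filter (fun w => ¬ dep w = 2 * m + 2)).filter (fun w => cl w = 1)) := by
            ext w
            simp only [Set.mem_setOf_eq, Finset.coe_filter, Finset.mem_filter, Set.Finite.mem_toFinset]
            constructor
            · rintro ⟨hw, hd, hc⟩
              exact ⟨⟨hw, by omega⟩, hc⟩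
            · rintro ⟨⟨hw, hne⟩, hc⟩
              rcases hlab w hw with ⟨h, -⟩ | ⟨h, -, -⟩
              · exact absurd h hne
              · exact ⟨hw, h, hc⟩
          rw [← hcP, hset, Set.ncard_coe_finset]
        have hcM' : ((hfin.toFinset.filter (fun w => ¬ dep w = 2 * m + 2)).filter (fun w => ¬ cl w = 1)).card = q.choose 2 := by
          have hset : {w | w ∈ GC v ∧ dep w = 2 * m + 1 ∧ cl w = -1} = ↑((hfin.toFinset.filter (fun w => ¬ dep w = 2 * m + 2)).filter (fun w => ¬ cl w = 1)) := by
            ext w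
            simp only [Set.mem_setOf_eq, Finset.coe_filter, Finset.mem_filter, Set.Finite.mem_toFinset]
            constructor
            · rintro ⟨hw, hd, hc⟩
              exact ⟨⟨hw, by omega⟩, by rw [hc]; norm_num⟩
            · rintro ⟨⟨hw, hne⟩, hc⟩
              rcases hlab w hw with ⟨h, -⟩ | ⟨h, -, hcw⟩
              · exact absurd h hne
              · exact ⟨hw, h, hcw.resolve_left hc⟩
          rw [← hcM, hset, Set.ncard_coe_finset]
        rw [hI4 hd2, hsplit, hsplit', Finset.sum_congr rfl hvE, Finset.sum_congr rfl hvP, Finset.sum_congr rfl hvM,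
          Finset.sum_const, Finset.sum_const, Finset.sum_const, hcE', hcP', hcM', if_neg (by omega), if_pos hr2,
          if_neg (by rw [hm, Nat.even_add_one, Nat.even_add_one, Nat.even_add_one, Nat.even_mul]; simp), hm,
          show (2 * m + 3) / 2 = m + 1 by omega, hTOs, smul_add]
        abel



/-! ## §3b The root: the total strata vector of the fixed self-dual vertices -/

/-- **THE ROOT ASSEMBLY (B7 of the blueprint, abstract form).**  If moreover the root `r` is fixed, self-dual, of depth `≥ 2`, and its fixed grandchildren are `NE` vertices of
label `E_{k+1} = (2k+2, 2)`, `NP` of label `P⁺_k`, `NM` of label `P⁻_k` and nothing else (the EQUILATERAL root: ★ `card_rootNull` ∕ `signedSum_card_rootNull_twists` count the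
null lines, ★ `DepthZeroKappaTransferTypeOneRamifiedRootClassSplit` the classes, `q` vertices per line), then the TOTAL strata vector of the fixed self-dual vertices is
`e₄ + NE·T(E_{k+1}) + NP·T(P⁺_k) + NM·T(P⁻_k)`. [cite: Kottwitz1986, §3] [cite: Rogawski1990, §4.9 pp. 54–56] -/
theorem strataVec_total_eq_of_localLaw_of_root (hT : G.IsTree) (r : V) (F : Set V) (hFfin : F.Finite)
    (hF : ∀ w ∈ F, w ≠ r → ∀ u, G.Adj w u → G.dist r u + 1 = G.dist r w → u ∈ F) (SD : V → Prop) (str : Fin 5 → V → Prop)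
    [DecidablePred (· ∈ F)] [DecidablePred SD] [∀ j, DecidablePred (str j)]
    (hSD₁ : ∀ v c, G.Adj v c → SD v → ¬ SD c) (hSD₂ : ∀ c w, G.Adj c w → ¬ SD c → SD w)
    (dep rk : V → ℕ) (cl : V → ℤ)
    (hstr : ∀ w ∈ F, SD w → (str 0 w ↔ dep w = 0) ∧ (str 1 w ↔ dep w = 1 ∧ rk w = 2) ∧ (str 2 w ↔ dep w = 1 ∧ rk w = 1 ∧ cl w = 1) ∧
      (str 3 w ↔ dep w = 1 ∧ rk w = 1 ∧ cl w = -1) ∧ (str 4 w ↔ 2 ≤ dep w))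
    (GC : V → Set V)
    (hGC : ∀ v w, w ∈ GC v ↔ ∃ c, (G.Adj v c ∧ G.dist r c = G.dist r v + 1 ∧ c ∈ F) ∧ (G.Adj c w ∧ G.dist r w = G.dist r c + 1 ∧ w ∈ F))
    (q : ℕ) (s : ℤ)
    (hrk : ∀ v ∈ F, SD v → v ≠ r → 1 ≤ dep v → rk v = 1 ∨ rk v = 2)
    (hcl : ∀ v ∈ F, SD v → v ≠ r → rk v = 1 → cl v = 1 ∨ cl v = -1)
    (hodd : ∀ v ∈ F, SD v → v ≠ r → 2 ≤ dep v → rk v = 1 → Odd (dep v))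
    (hB : ∀ v ∈ F, SD v → v ≠ r → dep v = 0 → GC v = ∅)
    (hC : ∀ v ∈ F, SD v → v ≠ r → dep v = 1 → rk v = 1 → GC v = ∅)
    (hR : ∀ v ∈ F, SD v → v ≠ r → dep v = 1 → rk v = 2 → (∀ w ∈ GC v, dep w = 0) ∧ (GC v).ncard = q)
    (hE : ∀ v ∈ F, SD v → v ≠ r → ∀ m, dep v = 2 * m + 2 → rk v = 2 → (∀ w ∈ GC v, dep w = 2 * m + 1 ∧ rk w = 2) ∧ (GC v).ncard = q ^ 2)
    (hO : ∀ v ∈ F, SD v → v ≠ r → ∀ m, dep v = 2 * m + 3 → rk v = 2 →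
      (∀ w ∈ GC v, (dep w = 2 * m + 2 ∧ rk w = 2) ∨ (dep w = 2 * m + 1 ∧ rk w = 1 ∧ (cl w = 1 ∨ cl w = -1))) ∧
        {w | w ∈ GC v ∧ dep w = 2 * m + 2}.ncard = q ∧ {w | w ∈ GC v ∧ dep w = 2 * m + 1 ∧ cl w = 1}.ncard = q.choose 2 ∧
          {w | w ∈ GC v ∧ dep w = 2 * m + 1 ∧ cl w = -1}.ncard = q.choose 2)
    (hP : ∀ v ∈ F, SD v → v ≠ r → ∀ m (c : ℤ), dep v = 2 * m + 3 → rk v = 1 → cl v = c →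
      (∀ w ∈ GC v, dep w = 2 * m + 1 ∧ rk w = 1 ∧ cl w = s * c) ∧ (GC v).ncard = q ^ 2)
    (TE TO : ℕ → Fin 5 → ℕ) (TP : ℤ → ℕ → Fin 5 → ℕ)
    (hTE : ∀ m, TE (m + 1) = ![0, 0, 0, 0, 1] + q ^ 2 • TO m)
    (hTO0 : TO 0 = ![0, 1, 0, 0, 0] + q • ![1, 0, 0, 0, 0])
    (hTOs : ∀ m, TO (m + 1) = ![0, 0, 0, 0, 1] + q • TE (m + 1) + q.choose 2 • (TP 1 m + TP (-1) m))
    (hTP0 : TP 1 0 = ![0, 0, 1, 0, 0]) (hTP0' : TP (-1) 0 = ![0, 0, 0, 1, 0])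
    (hTPs : ∀ m (c : ℤ), c = 1 ∨ c = -1 → TP c (m + 1) = ![0, 0, 0, 0, 1] + q ^ 2 • TP (s * c) m)
    (hrF : r ∈ F) (hrS : SD r) (hrdep : 2 ≤ dep r) (k NE NP NM : ℕ)
    (hroot : (∀ w ∈ GC r, (dep w = 2 * k + 2 ∧ rk w = 2) ∨ (dep w = 2 * k + 1 ∧ rk w = 1 ∧ (cl w = 1 ∨ cl w = -1))) ∧
      {w | w ∈ GC r ∧ dep w = 2 * k + 2}.ncard = NE ∧ {w | w ∈ GC r ∧ dep w = 2 * k + 1 ∧ cl w = 1}.ncard = NP ∧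
        {w | w ∈ GC r ∧ dep w = 2 * k + 1 ∧ cl w = -1}.ncard = NM) :
    (fun j => (F ∩ {w | SD w ∧ str j w}).ncard) = ![0, 0, 0, 0, 1] + NE • TE (k + 1) + NP • TP 1 k + NM • TP (-1) k := by
  -- the cone of the root is everything
  have hcone : (fun j => (F ∩ {w | SD w ∧ str j w}).ncard) = fun j => ({w | G.dist r w = G.dist r r + G.dist r w} ∩ F ∩ {w | SD w ∧ str j w}).ncard := by
    funext j
    congr 1
    symm
    rw [Set.inter_assoc]
    exact Set.inter_eq_right.2 (fun w _ => by simp only [Set.mem_setOf_eq, SimpleGraph.dist_self, zero_add])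
  rw [hcone]
  have hGCF : GC r ⊆ F := fun w hw => by
    obtain ⟨c, -, -, -, hwF⟩ := (hGC r w).1 hw
    exact hwF
  have hGCmem : ∀ w ∈ GC r, w ∈ F ∧ SD w ∧ w ≠ r := by
    intro w hw
    obtain ⟨c, ⟨hvc, hdc, -⟩, hcw, hdw, hwF⟩ := (hGC r w).1 hw
    refine ⟨hwF, hSD₂ c w hcw (hSD₁ r c hvc hrS), ?_⟩
    rintro rfl
    rw [SimpleGraph.dist_self] at hdw
    omega
  have hfin : (GC r).Finite := hFfin.subset hGCF
  have hsF : ∀ w, w ∈ hfin.toFinset ↔ w ∈ GC r := fun w => Set.Finite.mem_toFinset _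
  rw [strataVec_cone_eq_indicator_add_sum hT r r F hFfin hF SD str (fun c hadj _ => hSD₁ r c hadj hrS) (GC r) (hGC r) hfin.toFinset hsF,
    (strataIndicator_eq_of_label (F := F) (SD := SD) (str := str) (dep := dep) (rk := rk) (cl := cl) hrF hrS (hstr r hrF hrS)).2.2.2.2 hrdep]
  -- every grandchild's cone by the induction theorem
  have main : ∀ w ∈ GC r,
      (fun j => ({u | G.dist r u = G.dist r w + G.dist w u} ∩ F ∩ {u | SD u ∧ str j u}).ncard) =
        if dep w = 0 then ![1, 0, 0, 0, 0]
        else if rk w = 2 then (if Even (dep w) then TE (dep w / 2) else TO (dep w / 2)) else TP (cl w) (dep w / 2) := by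
    intro w hw
    obtain ⟨hwF, hwS, hwr⟩ := hGCmem w hw
    exact strataVec_cone_eq_of_localLaw hT r F hFfin hF SD str hSD₁ hSD₂ dep rk cl hstr GC hGC q s hrk hcl hodd hB hC hR hE hO hP TE TO TP
      hTE hTO0 hTOs hTP0 hTP0' hTPs hwF hwS hwr
  obtain ⟨hlab, hcE, hcP, hcM⟩ := hroot
  have hsplit := (Finset.sum_filter_add_sum_filter_not hfin.toFinset (fun w => dep w = 2 * k + 2)
    (fun w => (fun j => ({u | G.dist r u = G.dist r w + G.dist w u} ∩ F ∩ {u | SD u ∧ str j u}).ncard))).symm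
  have hsplit' := (Finset.sum_filter_add_sum_filter_not (hfin.toFinset.filter (fun w => ¬ dep w = 2 * k + 2)) (fun w => cl w = 1)
    (fun w => (fun j => ({u | G.dist r u = G.dist r w + G.dist w u} ∩ F ∩ {u | SD u ∧ str j u}).ncard))).symm
  have hvE : ∀ w ∈ hfin.toFinset.filter (fun w => dep w = 2 * k + 2),
      (fun j => ({u | G.dist r u = G.dist r w + G.dist w u} ∩ F ∩ {u | SD u ∧ str j u}).ncard) = TE (k + 1) := by
    intro w hw
    rw [Finset.mem_filter] at hw
    have hw' := (hsF w).1 hw.1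
    have hrw : rk w = 2 := by
      rcases hlab w hw' with ⟨-, h⟩ | ⟨h, -⟩
      · exact h
      · omega
    rw [main w hw', if_neg (by omega), if_pos hrw, if_pos (by rw [hw.2]; exact ⟨k + 1, by ring⟩), hw.2, show (2 * k + 2) / 2 = k + 1 by omega]
  have hvP : ∀ w ∈ (hfin.toFinset.filter (fun w => ¬ dep w = 2 * k + 2)).filter (fun w => cl w = 1),
      (fun j => ({u | G.dist r u = G.dist r w + G.dist w u} ∩ F ∩ {u | SD u ∧ str j u}).ncard) = TP 1 k := by
    intro w hw
    rw [Finset.mem_filter, Finset.mem_filter] at hw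
    have hw' := (hsF w).1 hw.1.1
    obtain ⟨hdw, hrw, -⟩ : dep w = 2 * k + 1 ∧ rk w = 1 ∧ (cl w = 1 ∨ cl w = -1) := by
      rcases hlab w hw' with ⟨h, -⟩ | h
      · exact absurd h hw.1.2
      · exact h
    rw [main w hw', if_neg (by omega), if_neg (by omega), hw.2, hdw, show (2 * k + 1) / 2 = k by omega]
  have hvM : ∀ w ∈ (hfin.toFinset.filter (fun w => ¬ dep w = 2 * k + 2)).filter (fun w => ¬ cl w = 1),
      (fun j => ({u | G.dist r u = G.dist r w + G.dist w u} ∩ F ∩ {u | SD u ∧ str j u}).ncard) = TP (-1) k := by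
    intro w hw
    rw [Finset.mem_filter, Finset.mem_filter] at hw
    have hw' := (hsF w).1 hw.1.1
    obtain ⟨hdw, hrw, hcw⟩ : dep w = 2 * k + 1 ∧ rk w = 1 ∧ (cl w = 1 ∨ cl w = -1) := by
      rcases hlab w hw' with ⟨h, -⟩ | h
      · exact absurd h hw.1.2
      · exact h
    have hc : cl w = -1 := hcw.resolve_left hw.2
    rw [main w hw', if_neg (by omega), if_neg (by omega), hc, hdw, show (2 * k + 1) / 2 = k by omega]
  have hcE' : (hfin.toFinset.filter (fun w => dep w = 2 * k + 2)).card = NE := by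
    have hset : {w | w ∈ GC r ∧ dep w = 2 * k + 2} = ↑(hfin.toFinset.filter (fun w => dep w = 2 * k + 2)) := by
      ext w
      simp only [Set.mem_setOf_eq, Finset.coe_filter, Set.Finite.mem_toFinset]
    rw [← hcE, hset, Set.ncard_coe_finset]
  have hcP' : ((hfin.toFinset.filter (fun w => ¬ dep w = 2 * k + 2)).filter (fun w => cl w = 1)).card = NP := by
    have hset : {w | w ∈ GC r ∧ dep w = 2 * k + 1 ∧ cl w = 1} = ↑((hfin.toFinset.filter (fun w => ¬ dep w = 2 * k + 2)).filter (fun w => cl w = 1)) := by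
      ext w
      simp only [Set.mem_setOf_eq, Finset.coe_filter, Finset.mem_filter, Set.Finite.mem_toFinset]
      constructor
      · rintro ⟨hw, hd, hc⟩
        exact ⟨⟨hw, by omega⟩, hc⟩
      · rintro ⟨⟨hw, hne⟩, hc⟩
        rcases hlab w hw with ⟨h, -⟩ | ⟨h, -, -⟩
        · exact absurd h hne
        · exact ⟨hw, h, hc⟩
    rw [← hcP, hset, Set.ncard_coe_finset]
  have hcM' : ((hfin.toFinset.filter (fun w => ¬ dep w = 2 * k + 2)).filter (fun w => ¬ cl w = 1)).card = NM := by
    have hset : {w | w ∈ GC r ∧ dep w = 2 * k + 1 ∧ cl w = -1} = ↑((hfin.toFinset.filter (fun w => ¬ dep w = 2 * k + 2)).filter (fun w => ¬ cl w = 1)) := by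
      ext w
      simp only [Set.mem_setOf_eq, Finset.coe_filter, Finset.mem_filter, Set.Finite.mem_toFinset]
      constructor
      · rintro ⟨hw, hd, hc⟩
        exact ⟨⟨hw, by omega⟩, by rw [hc]; norm_num⟩
      · rintro ⟨⟨hw, hne⟩, hc⟩
        rcases hlab w hw with ⟨h, -⟩ | ⟨h, -, hcw⟩
        · exact absurd h hne
        · exact ⟨hw, h, hcw.resolve_left hc⟩
    rw [← hcM, hset, Set.ncard_coe_finset]
  rw [hsplit, hsplit', Finset.sum_congr rfl hvE, Finset.sum_congr rfl hvP, Finset.sum_congr rfl hvM,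
    Finset.sum_const, Finset.sum_const, Finset.sum_const, hcE', hcP', hcM']
  abel

/-! ## §4 The ★ closed forms are a solution of the shell recursion: the induction with explicit totals -/

/-- **THE TREE INDUCTION WITH THE ★ CLOSED FORMS, class-FLIP variant (`s = −1`, i.e. `χ(−1) = −1`, `q ≡ 3 (4)`)**: under the local branching law, the strata vector of
the cone of a fixed self-dual non-root vertex is `S(B) = e₀`, `S(O_m) = (q^{3m+1}, q^{3m}, C(q,2)q^{2m−2}Σ_{i<m}qⁱ, same, Σ_{i<m}q^{2i} + Σ_{i<m}q^{2m−1+i})`, `S(E_m)` (the same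
shape one step up), `S(P^±_m) = (0, 0, [m even ∕ odd]·q^{2m}, [m odd ∕ even]·q^{2m}, Σ_{i<m}q^{2i})` — ★ `shellSum_E_succ`, `shellSum_O_zero`, `shellSum_O_succ`, `shellSum_P_{pos,neg}_succ`
discharge the recursion hypotheses of `strataVec_cone_eq_of_localLaw`. [cite: Kottwitz1986, §3] [cite: Rogawski1990, §4.9 pp. 54–56] -/
theorem strataVec_cone_eq_shellSum_of_localLaw_flip (hT : G.IsTree) (r : V) (F : Set V) (hFfin : F.Finite)
    (hF : ∀ w ∈ F, w ≠ r → ∀ u, G.Adj w u → G.dist r u + 1 = G.dist r w → u ∈ F) (SD : V → Prop) (str : Fin 5 → V → Prop)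
    [DecidablePred (· ∈ F)] [DecidablePred SD] [∀ j, DecidablePred (str j)]
    (hSD₁ : ∀ v c, G.Adj v c → SD v → ¬ SD c) (hSD₂ : ∀ c w, G.Adj c w → ¬ SD c → SD w)
    (dep rk : V → ℕ) (cl : V → ℤ)
    (hstr : ∀ w ∈ F, SD w → (str 0 w ↔ dep w = 0) ∧ (str 1 w ↔ dep w = 1 ∧ rk w = 2) ∧ (str 2 w ↔ dep w = 1 ∧ rk w = 1 ∧ cl w = 1) ∧
      (str 3 w ↔ dep w = 1 ∧ rk w = 1 ∧ cl w = -1) ∧ (str 4 w ↔ 2 ≤ dep w))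
    (GC : V → Set V)
    (hGC : ∀ v w, w ∈ GC v ↔ ∃ c, (G.Adj v c ∧ G.dist r c = G.dist r v + 1 ∧ c ∈ F) ∧ (G.Adj c w ∧ G.dist r w = G.dist r c + 1 ∧ w ∈ F))
    (q : ℕ)
    (hrk : ∀ v ∈ F, SD v → v ≠ r → 1 ≤ dep v → rk v = 1 ∨ rk v = 2)
    (hcl : ∀ v ∈ F, SD v → v ≠ r → rk v = 1 → cl v = 1 ∨ cl v = -1)
    (hodd : ∀ v ∈ F, SD v → v ≠ r → 2 ≤ dep v → rk v = 1 → Odd (dep v))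
    (hB : ∀ v ∈ F, SD v → v ≠ r → dep v = 0 → GC v = ∅)
    (hC : ∀ v ∈ F, SD v → v ≠ r → dep v = 1 → rk v = 1 → GC v = ∅)
    (hR : ∀ v ∈ F, SD v → v ≠ r → dep v = 1 → rk v = 2 → (∀ w ∈ GC v, dep w = 0) ∧ (GC v).ncard = q)
    (hE : ∀ v ∈ F, SD v → v ≠ r → ∀ m, dep v = 2 * m + 2 → rk v = 2 → (∀ w ∈ GC v, dep w = 2 * m + 1 ∧ rk w = 2) ∧ (GC v).ncard = q ^ 2)
    (hO : ∀ v ∈ F, SD v → v ≠ r → ∀ m, dep v = 2 * m + 3 → rk v = 2 →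
      (∀ w ∈ GC v, (dep w = 2 * m + 2 ∧ rk w = 2) ∨ (dep w = 2 * m + 1 ∧ rk w = 1 ∧ (cl w = 1 ∨ cl w = -1))) ∧
        {w | w ∈ GC v ∧ dep w = 2 * m + 2}.ncard = q ∧ {w | w ∈ GC v ∧ dep w = 2 * m + 1 ∧ cl w = 1}.ncard = q.choose 2 ∧
          {w | w ∈ GC v ∧ dep w = 2 * m + 1 ∧ cl w = -1}.ncard = q.choose 2)
    (hP : ∀ v ∈ F, SD v → v ≠ r → ∀ m (c : ℤ), dep v = 2 * m + 3 → rk v = 1 → cl v = c →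
      (∀ w ∈ GC v, dep w = 2 * m + 1 ∧ rk w = 1 ∧ cl w = (-1) * c) ∧ (GC v).ncard = q ^ 2)
    {v : V} (hv : v ∈ F) (hvS : SD v) (hvr : v ≠ r) :
    (fun j => ({w | G.dist r w = G.dist r v + G.dist v w} ∩ F ∩ {w | SD w ∧ str j w}).ncard) =
      if dep v = 0 then ![1, 0, 0, 0, 0]
      else if rk v = 2 then
        (if Even (dep v) then
          (fun n : ℕ => (![q ^ (3 * (n - 1) + 3), q ^ (3 * (n - 1) + 2), q.choose 2 * q ^ (2 * (n - 1)) * ∑ i ∈ range (n - 1), q ^ i,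
            q.choose 2 * q ^ (2 * (n - 1)) * ∑ i ∈ range (n - 1), q ^ i, ∑ i ∈ range (n - 1 + 1), q ^ (2 * i) + ∑ i ∈ range (n - 1), q ^ (2 * (n - 1) + 1 + i)] : Fin 5 → ℕ))
            (dep v / 2)
        else
          (fun m : ℕ => (![q ^ (3 * m + 1), q ^ (3 * m), q.choose 2 * q ^ (2 * m - 2) * ∑ i ∈ range m, q ^ i, q.choose 2 * q ^ (2 * m - 2) * ∑ i ∈ range m, q ^ i,
            ∑ i ∈ range m, q ^ (2 * i) + ∑ i ∈ range m, q ^ (2 * m - 1 + i)] : Fin 5 → ℕ)) (dep v / 2))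
      else
        (fun (c : ℤ) (m : ℕ) => if c = 1 then (![0, 0, if Even m then q ^ (2 * m) else 0, if Even m then 0 else q ^ (2 * m), ∑ i ∈ range m, q ^ (2 * i)] : Fin 5 → ℕ)
          else (![0, 0, if Even m then 0 else q ^ (2 * m), if Even m then q ^ (2 * m) else 0, ∑ i ∈ range m, q ^ (2 * i)] : Fin 5 → ℕ)) (cl v) (dep v / 2) := by
  refine strataVec_cone_eq_of_localLaw hT r F hFfin hF SD str hSD₁ hSD₂ dep rk cl hstr GC hGC q (-1) hrk hcl hodd hB hC hR hE hO hP
    (fun n : ℕ => (![q ^ (3 * (n - 1) + 3), q ^ (3 * (n - 1) + 2), q.choose 2 * q ^ (2 * (n - 1)) * ∑ i ∈ range (n - 1), q ^ i,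
        q.choose 2 * q ^ (2 * (n - 1)) * ∑ i ∈ range (n - 1), q ^ i, ∑ i ∈ range (n - 1 + 1), q ^ (2 * i) + ∑ i ∈ range (n - 1), q ^ (2 * (n - 1) + 1 + i)] : Fin 5 → ℕ))
    (fun m : ℕ => (![q ^ (3 * m + 1), q ^ (3 * m), q.choose 2 * q ^ (2 * m - 2) * ∑ i ∈ range m, q ^ i, q.choose 2 * q ^ (2 * m - 2) * ∑ i ∈ range m, q ^ i,
        ∑ i ∈ range m, q ^ (2 * i) + ∑ i ∈ range m, q ^ (2 * m - 1 + i)] : Fin 5 → ℕ))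
    (fun (c : ℤ) (m : ℕ) => if c = 1 then (![0, 0, if Even m then q ^ (2 * m) else 0, if Even m then 0 else q ^ (2 * m), ∑ i ∈ range m, q ^ (2 * i)] : Fin 5 → ℕ)
        else (![0, 0, if Even m then 0 else q ^ (2 * m), if Even m then q ^ (2 * m) else 0, ∑ i ∈ range m, q ^ (2 * i)] : Fin 5 → ℕ))
    ?_ ?_ ?_ ?_ ?_ ?_ hv hvS hvr
  · intro m
    simp only [Nat.add_sub_cancel]
    exact shellSum_E_succ q m
  · exact shellSum_O_zero q
  · intro m
    simp only [Nat.add_sub_cancel, if_true, show ((-1 : ℤ) = 1) = False from propext ⟨fun h => by norm_num at h, False.elim⟩, if_false]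
    exact shellSum_O_succ q m
  · simp
  · simp
  · intro m c hc
    rcases hc with rfl | rfl
    · simp only [if_true, mul_one, show ((-1 : ℤ) = 1) = False from propext ⟨fun h => by norm_num at h, False.elim⟩, if_false]
      exact shellSum_P_pos_succ q m
    · simp only [show ((-1 : ℤ) = 1) = False from propext ⟨fun h => by norm_num at h, False.elim⟩, if_false, mul_neg, mul_one, neg_neg, if_true]
      exact shellSum_P_neg_succ q m

/-- **THE TREE INDUCTION WITH THE ★ CLOSED FORMS, class-KEEP variant (`s = 1`, i.e. `χ(−1) = 1`, `q ≡ 1 (4)`)**: as the flip variant with `S(P⁺_m) = (0, 0, q^{2m}, 0, Σ_{i<m}q^{2i})`,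
`S(P⁻_m) = (0, 0, 0, q^{2m}, Σ_{i<m}q^{2i})` — ★ ED. 2 `shellSum_P_keep_pos_succ`, `shellSum_P_keep_neg_succ`, `shellSum_O_succ_keep`. [cite: Kottwitz1986, §3] [cite: Rogawski1990, §4.9 pp. 54–56] -/
theorem strataVec_cone_eq_shellSum_of_localLaw_keep (hT : G.IsTree) (r : V) (F : Set V) (hFfin : F.Finite)
    (hF : ∀ w ∈ F, w ≠ r → ∀ u, G.Adj w u → G.dist r u + 1 = G.dist r w → u ∈ F) (SD : V → Prop) (str : Fin 5 → V → Prop)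
    [DecidablePred (· ∈ F)] [DecidablePred SD] [∀ j, DecidablePred (str j)]
    (hSD₁ : ∀ v c, G.Adj v c → SD v → ¬ SD c) (hSD₂ : ∀ c w, G.Adj c w → ¬ SD c → SD w)
    (dep rk : V → ℕ) (cl : V → ℤ)
    (hstr : ∀ w ∈ F, SD w → (str 0 w ↔ dep w = 0) ∧ (str 1 w ↔ dep w = 1 ∧ rk w = 2) ∧ (str 2 w ↔ dep w = 1 ∧ rk w = 1 ∧ cl w = 1) ∧
      (str 3 w ↔ dep w = 1 ∧ rk w = 1 ∧ cl w = -1) ∧ (str 4 w ↔ 2 ≤ dep w))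
    (GC : V → Set V)
    (hGC : ∀ v w, w ∈ GC v ↔ ∃ c, (G.Adj v c ∧ G.dist r c = G.dist r v + 1 ∧ c ∈ F) ∧ (G.Adj c w ∧ G.dist r w = G.dist r c + 1 ∧ w ∈ F))
    (q : ℕ)
    (hrk : ∀ v ∈ F, SD v → v ≠ r → 1 ≤ dep v → rk v = 1 ∨ rk v = 2)
    (hcl : ∀ v ∈ F, SD v → v ≠ r → rk v = 1 → cl v = 1 ∨ cl v = -1)
    (hodd : ∀ v ∈ F, SD v → v ≠ r → 2 ≤ dep v → rk v = 1 → Odd (dep v))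
    (hB : ∀ v ∈ F, SD v → v ≠ r → dep v = 0 → GC v = ∅)
    (hC : ∀ v ∈ F, SD v → v ≠ r → dep v = 1 → rk v = 1 → GC v = ∅)
    (hR : ∀ v ∈ F, SD v → v ≠ r → dep v = 1 → rk v = 2 → (∀ w ∈ GC v, dep w = 0) ∧ (GC v).ncard = q)
    (hE : ∀ v ∈ F, SD v → v ≠ r → ∀ m, dep v = 2 * m + 2 → rk v = 2 → (∀ w ∈ GC v, dep w = 2 * m + 1 ∧ rk w = 2) ∧ (GC v).ncard = q ^ 2)
    (hO : ∀ v ∈ F, SD v → v ≠ r → ∀ m, dep v = 2 * m + 3 → rk v = 2 →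
      (∀ w ∈ GC v, (dep w = 2 * m + 2 ∧ rk w = 2) ∨ (dep w = 2 * m + 1 ∧ rk w = 1 ∧ (cl w = 1 ∨ cl w = -1))) ∧
        {w | w ∈ GC v ∧ dep w = 2 * m + 2}.ncard = q ∧ {w | w ∈ GC v ∧ dep w = 2 * m + 1 ∧ cl w = 1}.ncard = q.choose 2 ∧
          {w | w ∈ GC v ∧ dep w = 2 * m + 1 ∧ cl w = -1}.ncard = q.choose 2)
    (hP : ∀ v ∈ F, SD v → v ≠ r → ∀ m (c : ℤ), dep v = 2 * m + 3 → rk v = 1 → cl v = c →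
      (∀ w ∈ GC v, dep w = 2 * m + 1 ∧ rk w = 1 ∧ cl w = 1 * c) ∧ (GC v).ncard = q ^ 2)
    {v : V} (hv : v ∈ F) (hvS : SD v) (hvr : v ≠ r) :
    (fun j => ({w | G.dist r w = G.dist r v + G.dist v w} ∩ F ∩ {w | SD w ∧ str j w}).ncard) =
      if dep v = 0 then ![1, 0, 0, 0, 0]
      else if rk v = 2 then
        (if Even (dep v) then
          (fun n : ℕ => (![q ^ (3 * (n - 1) + 3), q ^ (3 * (n - 1) + 2), q.choose 2 * q ^ (2 * (n - 1)) * ∑ i ∈ range (n - 1), q ^ i,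
            q.choose 2 * q ^ (2 * (n - 1)) * ∑ i ∈ range (n - 1), q ^ i, ∑ i ∈ range (n - 1 + 1), q ^ (2 * i) + ∑ i ∈ range (n - 1), q ^ (2 * (n - 1) + 1 + i)] : Fin 5 → ℕ))
            (dep v / 2)
        else
          (fun m : ℕ => (![q ^ (3 * m + 1), q ^ (3 * m), q.choose 2 * q ^ (2 * m - 2) * ∑ i ∈ range m, q ^ i, q.choose 2 * q ^ (2 * m - 2) * ∑ i ∈ range m, q ^ i,
            ∑ i ∈ range m, q ^ (2 * i) + ∑ i ∈ range m, q ^ (2 * m - 1 + i)] : Fin 5 → ℕ)) (dep v / 2))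
      else
        (fun (c : ℤ) (m : ℕ) => if c = 1 then (![0, 0, q ^ (2 * m), 0, ∑ i ∈ range m, q ^ (2 * i)] : Fin 5 → ℕ)
          else (![0, 0, 0, q ^ (2 * m), ∑ i ∈ range m, q ^ (2 * i)] : Fin 5 → ℕ)) (cl v) (dep v / 2) := by
  refine strataVec_cone_eq_of_localLaw hT r F hFfin hF SD str hSD₁ hSD₂ dep rk cl hstr GC hGC q 1 hrk hcl hodd hB hC hR hE hO hP
    (fun n : ℕ => (![q ^ (3 * (n - 1) + 3), q ^ (3 * (n - 1) + 2), q.choose 2 * q ^ (2 * (n - 1)) * ∑ i ∈ range (n - 1), q ^ i,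
        q.choose 2 * q ^ (2 * (n - 1)) * ∑ i ∈ range (n - 1), q ^ i, ∑ i ∈ range (n - 1 + 1), q ^ (2 * i) + ∑ i ∈ range (n - 1), q ^ (2 * (n - 1) + 1 + i)] : Fin 5 → ℕ))
    (fun m : ℕ => (![q ^ (3 * m + 1), q ^ (3 * m), q.choose 2 * q ^ (2 * m - 2) * ∑ i ∈ range m, q ^ i, q.choose 2 * q ^ (2 * m - 2) * ∑ i ∈ range m, q ^ i,
        ∑ i ∈ range m, q ^ (2 * i) + ∑ i ∈ range m, q ^ (2 * m - 1 + i)] : Fin 5 → ℕ))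
    (fun (c : ℤ) (m : ℕ) => if c = 1 then (![0, 0, q ^ (2 * m), 0, ∑ i ∈ range m, q ^ (2 * i)] : Fin 5 → ℕ)
        else (![0, 0, 0, q ^ (2 * m), ∑ i ∈ range m, q ^ (2 * i)] : Fin 5 → ℕ))
    ?_ ?_ ?_ ?_ ?_ ?_ hv hvS hvr
  · intro m
    simp only [Nat.add_sub_cancel]
    exact shellSum_E_succ q m
  · exact shellSum_O_zero q
  · intro m
    simp only [Nat.add_sub_cancel, if_true, show ((-1 : ℤ) = 1) = False from propext ⟨fun h => by norm_num at h, False.elim⟩, if_false]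
    exact shellSum_O_succ_keep q m
  · simp
  · simp
  · intro m c hc
    rcases hc with rfl | rfl
    · simp only [if_true, mul_one]
      exact shellSum_P_keep_pos_succ q m
    · simp only [show ((-1 : ℤ) = 1) = False from propext ⟨fun h => by norm_num at h, False.elim⟩, if_false, mul_neg, mul_one]
      exact shellSum_P_keep_neg_succ q m


/-! ## §5 (ED. 2) The ISOCELES configuration: the AXIS label family, and induction on the size of the cone

In the isoceles configuration `N₁ = N₂ = d₀ < N` (B-p14 (g39) CENSUS-G6-axis ba7b3992, ★ `DepthZeroKappaTransferTypeOneRamifiedAxisTwists` p847236, ★ G7 p847311) the fixed subtree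
of an AXIS literal carries, besides the nilpotent-regime labels `E ∕ O ∕ P ∕ R ∕ C ∕ B`, a family of AXIS vertices `A_j` (semisimple regime, all of depth `d₀`; `j` = remaining
axis steps): an INTERIOR axis vertex `A_{j+1}` has `q` fixed grandchildren `A_j` and `q_P` of label `P^{c_R}_{m_A}` (`q_P = (q−1)q` in the census), a BOUNDARY axis vertex `A_0`
has `NE₀` of label `E_{m_A+1}`, `NP₀` of `P⁺_{m_A}`, `NM₀` of `P⁻_{m_A}` (BIG: `2q, (q−3)q∕2, (q−1)q∕2`; SMALL: `0, (q−1)q∕2, (q+1)q∕2`).  The engine is re-run with this fourth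
family (axis ⟺ `rk = 3`, `ax : V → ℕ` the step counter) by induction on the SIZE OF THE CONE `#(Desc v ∩ F)` (strictly decreasing to grandchildren — law-independent), so that
the depth need not decrease along the axis. -/

/-- **The cone of a fixed grandchild is strictly smaller** (as a finite set of fixed vertices): `w ∈ GC v ⇒ #(Desc w ∩ F) < #(Desc v ∩ F)` — `Desc w ⊆ Desc v` (★
`setOf_dist_subset_of_mem`) and `v ∉ Desc w`. [cite: Serre1980Trees, I.2.3] -/
theorem ncard_cone_inter_lt_of_mem_grandchildren (hT : G.IsTree) (r v : V) (F : Set V) (hFfin : F.Finite) (hv : v ∈ F)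
    {w : V} (hw : ∃ c, (G.Adj v c ∧ G.dist r c = G.dist r v + 1 ∧ c ∈ F) ∧ (G.Adj c w ∧ G.dist r w = G.dist r c + 1 ∧ w ∈ F)) :
    ({u | G.dist r u = G.dist r w + G.dist w u} ∩ F).ncard < ({u | G.dist r u = G.dist r v + G.dist v u} ∩ F).ncard := by
  obtain ⟨c, ⟨hvc, hdc, -⟩, hcw, hdw, -⟩ := hw
  have hdw' : G.dist r w = G.dist r v + 2 := by rw [hdw, hdc]
  have hvw : G.dist v w = 2 := by
    refine le_antisymm ?_ ?_
    · have h := SimpleGraph.dist_le (SimpleGraph.Walk.cons hvc (SimpleGraph.Walk.cons hcw SimpleGraph.Walk.nil))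
      simpa using h
    · have htri := hT.connected.dist_triangle (u := r) (v := v) (w := w)
      omega
  have hsub : {u | G.dist r u = G.dist r w + G.dist w u} ⊆ {u | G.dist r u = G.dist r v + G.dist v u} :=
    setOf_dist_subset_of_mem hT r (by rw [hdw', hvw])
  have hvD : v ∈ {u | G.dist r u = G.dist r v + G.dist v u} ∩ F := ⟨by simp only [Set.mem_setOf_eq, SimpleGraph.dist_self, add_zero], hv⟩
  have hvnot : v ∉ {u | G.dist r u = G.dist r w + G.dist w u} := by
    intro h
    rw [Set.mem_setOf_eq] at h
    omega
  refine Set.ncard_lt_ncard (Set.ssubset_iff_subset_ne.2 ⟨Set.inter_subset_inter_left F hsub, fun heq => hvnot ?_⟩) (hFfin.subset Set.inter_subset_right)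
  rw [← heq] at hvD
  exact hvD.1

/-- **THE TREE INDUCTION WITH THE AXIS FAMILY (isoceles configuration).**  As `strataVec_cone_eq_of_localLaw`, with a fourth label family: AXIS vertices (`rk v = 3`, step counter
`ax v`, depth `≥ 2`) obeying the interior law `hAs` (`q_A` axis grandchildren one step on, `q_P` of label `P^{c_R}_{m_A}`) and the boundary law `hA0` (`NE₀ ∕ NP₀ ∕ NM₀`
grandchildren of labels `E_{m_A+1} ∕ P⁺_{m_A} ∕ P⁻_{m_A}`); the axis totals `TA j` are any solution of `hTA0`, `hTAs`.  Proof by induction on `#(Desc v ∩ F)`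
(`ncard_cone_inter_lt_of_mem_grandchildren`). [cite: Kottwitz1986, §3] [cite: Rogawski1990, §4.9 pp. 54–56] [cite: Serre1980Trees, I.2.3] -/
theorem strataVec_cone_eq_of_localLaw_axis (hT : G.IsTree) (r : V) (F : Set V) (hFfin : F.Finite)
    (hF : ∀ w ∈ F, w ≠ r → ∀ u, G.Adj w u → G.dist r u + 1 = G.dist r w → u ∈ F) (SD : V → Prop) (str : Fin 5 → V → Prop)
    [DecidablePred (· ∈ F)] [DecidablePred SD] [∀ j, DecidablePred (str j)]
    (hSD₁ : ∀ v c, G.Adj v c → SD v → ¬ SD c) (hSD₂ : ∀ c w, G.Adj c w → ¬ SD c → SD w)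
    (dep rk ax : V → ℕ) (cl : V → ℤ)
    (hstr : ∀ w ∈ F, SD w → (str 0 w ↔ dep w = 0) ∧ (str 1 w ↔ dep w = 1 ∧ rk w = 2) ∧ (str 2 w ↔ dep w = 1 ∧ rk w = 1 ∧ cl w = 1) ∧
      (str 3 w ↔ dep w = 1 ∧ rk w = 1 ∧ cl w = -1) ∧ (str 4 w ↔ 2 ≤ dep w))
    (GC : V → Set V)
    (hGC : ∀ v w, w ∈ GC v ↔ ∃ c, (G.Adj v c ∧ G.dist r c = G.dist r v + 1 ∧ c ∈ F) ∧ (G.Adj c w ∧ G.dist r w = G.dist r c + 1 ∧ w ∈ F))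
    (q : ℕ) (s : ℤ)
    (hrk : ∀ v ∈ F, SD v → v ≠ r → 1 ≤ dep v → rk v = 1 ∨ rk v = 2 ∨ rk v = 3)
    (hcl : ∀ v ∈ F, SD v → v ≠ r → rk v = 1 → cl v = 1 ∨ cl v = -1)
    (hodd : ∀ v ∈ F, SD v → v ≠ r → 2 ≤ dep v → rk v = 1 → Odd (dep v))
    (hAdep : ∀ v ∈ F, SD v → v ≠ r → rk v = 3 → 2 ≤ dep v)
    (hB : ∀ v ∈ F, SD v → v ≠ r → dep v = 0 → GC v = ∅)
    (hC : ∀ v ∈ F, SD v → v ≠ r → dep v = 1 → rk v = 1 → GC v = ∅)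
    (hR : ∀ v ∈ F, SD v → v ≠ r → dep v = 1 → rk v = 2 → (∀ w ∈ GC v, dep w = 0) ∧ (GC v).ncard = q)
    (hE : ∀ v ∈ F, SD v → v ≠ r → ∀ m, dep v = 2 * m + 2 → rk v = 2 → (∀ w ∈ GC v, dep w = 2 * m + 1 ∧ rk w = 2) ∧ (GC v).ncard = q ^ 2)
    (hO : ∀ v ∈ F, SD v → v ≠ r → ∀ m, dep v = 2 * m + 3 → rk v = 2 →
      (∀ w ∈ GC v, (dep w = 2 * m + 2 ∧ rk w = 2) ∨ (dep w = 2 * m + 1 ∧ rk w = 1 ∧ (cl w = 1 ∨ cl w = -1))) ∧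
        {w | w ∈ GC v ∧ dep w = 2 * m + 2}.ncard = q ∧ {w | w ∈ GC v ∧ dep w = 2 * m + 1 ∧ cl w = 1}.ncard = q.choose 2 ∧
          {w | w ∈ GC v ∧ dep w = 2 * m + 1 ∧ cl w = -1}.ncard = q.choose 2)
    (hP : ∀ v ∈ F, SD v → v ≠ r → ∀ m (c : ℤ), dep v = 2 * m + 3 → rk v = 1 → cl v = c →
      (∀ w ∈ GC v, dep w = 2 * m + 1 ∧ rk w = 1 ∧ cl w = s * c) ∧ (GC v).ncard = q ^ 2)
    -- the axis family
    (mA qA qP NE₀ NP₀ NM₀ : ℕ) (cR : ℤ)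
    (hAs : ∀ v ∈ F, SD v → v ≠ r → rk v = 3 → ∀ j, ax v = j + 1 →
      (∀ w ∈ GC v, (rk w = 3 ∧ ax w = j ∧ 1 ≤ dep w) ∨ (dep w = 2 * mA + 1 ∧ rk w = 1 ∧ cl w = cR)) ∧
        {w | w ∈ GC v ∧ rk w = 3}.ncard = qA ∧ {w | w ∈ GC v ∧ rk w = 1}.ncard = qP)
    (hA0 : ∀ v ∈ F, SD v → v ≠ r → rk v = 3 → ax v = 0 →
      (∀ w ∈ GC v, (dep w = 2 * mA + 2 ∧ rk w = 2) ∨ (dep w = 2 * mA + 1 ∧ rk w = 1 ∧ (cl w = 1 ∨ cl w = -1))) ∧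
        {w | w ∈ GC v ∧ dep w = 2 * mA + 2}.ncard = NE₀ ∧ {w | w ∈ GC v ∧ dep w = 2 * mA + 1 ∧ cl w = 1}.ncard = NP₀ ∧
          {w | w ∈ GC v ∧ dep w = 2 * mA + 1 ∧ cl w = -1}.ncard = NM₀)
    (TE TO TA : ℕ → Fin 5 → ℕ) (TP : ℤ → ℕ → Fin 5 → ℕ)
    (hTE : ∀ m, TE (m + 1) = ![0, 0, 0, 0, 1] + q ^ 2 • TO m)
    (hTO0 : TO 0 = ![0, 1, 0, 0, 0] + q • ![1, 0, 0, 0, 0])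
    (hTOs : ∀ m, TO (m + 1) = ![0, 0, 0, 0, 1] + q • TE (m + 1) + q.choose 2 • (TP 1 m + TP (-1) m))
    (hTP0 : TP 1 0 = ![0, 0, 1, 0, 0]) (hTP0' : TP (-1) 0 = ![0, 0, 0, 1, 0])
    (hTPs : ∀ m (c : ℤ), c = 1 ∨ c = -1 → TP c (m + 1) = ![0, 0, 0, 0, 1] + q ^ 2 • TP (s * c) m)
    (hTA0 : TA 0 = ![0, 0, 0, 0, 1] + NE₀ • TE (mA + 1) + NP₀ • TP 1 mA + NM₀ • TP (-1) mA)
    (hTAs : ∀ j, TA (j + 1) = ![0, 0, 0, 0, 1] + qA • TA j + qP • TP cR mA)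
    {v : V} (hv : v ∈ F) (hvS : SD v) (hvr : v ≠ r) :
    (fun j => ({w | G.dist r w = G.dist r v + G.dist v w} ∩ F ∩ {w | SD w ∧ str j w}).ncard) =
      if dep v = 0 then ![1, 0, 0, 0, 0]
      else if rk v = 2 then (if Even (dep v) then TE (dep v / 2) else TO (dep v / 2))
      else if rk v = 3 then TA (ax v) else TP (cl v) (dep v / 2) := by
  -- strong induction on the size of the cone
  suffices key : ∀ n (v : V), ({w | G.dist r w = G.dist r v + G.dist v w} ∩ F).ncard = n → v ∈ F → SD v → v ≠ r →
      (fun j => ({w | G.dist r w = G.dist r v + G.dist v w} ∩ F ∩ {w | SD w ∧ str j w}).ncard) =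
        if dep v = 0 then ![1, 0, 0, 0, 0]
        else if rk v = 2 then (if Even (dep v) then TE (dep v / 2) else TO (dep v / 2))
        else if rk v = 3 then TA (ax v) else TP (cl v) (dep v / 2) from
    key _ v rfl hv hvS hvr
  intro n
  induction n using Nat.strong_induction_on with
  | _ n ih =>
  intro v hnv hv hvS hvr
  have hGCF : GC v ⊆ F := fun w hw => by
    obtain ⟨c, -, -, -, hwF⟩ := (hGC v w).1 hw
    exact hwF
  have hGCmem : ∀ w ∈ GC v, w ∈ F ∧ SD w ∧ w ≠ r := by
    intro w hw
    obtain ⟨c, ⟨hvc, hdc, -⟩, hcw, hdw, hwF⟩ := (hGC v w).1 hw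
    refine ⟨hwF, hSD₂ c w hcw (hSD₁ v c hvc hvS), ?_⟩
    rintro rfl
    rw [SimpleGraph.dist_self] at hdw
    omega
  have hfin : (GC v).Finite := hFfin.subset hGCF
  have hsF : ∀ w, w ∈ hfin.toFinset ↔ w ∈ GC v := fun w => Set.Finite.mem_toFinset _
  have step := strataVec_cone_eq_indicator_add_sum hT r v F hFfin hF SD str (fun c hadj _ => hSD₁ v c hadj hvS) (GC v) (hGC v) hfin.toFinset hsF
  rw [step]
  obtain ⟨hI0, hI1, hI2, hI3, hI4⟩ :=
    strataIndicator_eq_of_label (F := F) (SD := SD) (str := str) (dep := dep) (rk := rk) (cl := cl) hv hvS (hstr v hv hvS)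
  -- the induction hypothesis at every grandchild (no depth bookkeeping: the cone shrinks)
  have ihw : ∀ w ∈ GC v,
      (fun j => ({u | G.dist r u = G.dist r w + G.dist w u} ∩ F ∩ {u | SD u ∧ str j u}).ncard) =
        if dep w = 0 then ![1, 0, 0, 0, 0]
        else if rk w = 2 then (if Even (dep w) then TE (dep w / 2) else TO (dep w / 2))
        else if rk w = 3 then TA (ax w) else TP (cl w) (dep w / 2) := by
    intro w hw
    obtain ⟨hwF, hwS, hwr⟩ := hGCmem w hw
    exact ih _ (hnv ▸ ncard_cone_inter_lt_of_mem_grandchildren hT r v F hFfin hv ((hGC v w).1 hw)) w rfl hwF hwS hwr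
  have hcardGC : hfin.toFinset.card = (GC v).ncard := (Set.ncard_eq_toFinset_card _ hfin).symm
  -- a helper: regroup a sum of constant blocks over a three-way label split of `GC v`
  rcases Nat.eq_zero_or_pos (dep v) with hd0 | hdpos
  · -- label B: a leaf
    have hempty : hfin.toFinset = ∅ := by
      rw [Finset.eq_empty_iff_forall_notMem]
      intro w hw
      have := (hsF w).1 hw
      rw [hB v hv hvS hvr hd0] at this
      exact this
    rw [hI0 hd0, hempty, Finset.sum_empty, add_zero, if_pos hd0]
  rcases hrk v hv hvS hvr hdpos with hr1 | hr2 | hr3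
  · -- rank one: `C^c` (depth 1) or `P^c_{m+1}` (depth `2m+3`)
    have hcv := hcl v hv hvS hvr hr1
    rcases Nat.lt_or_ge (dep v) 2 with hd1 | hd2
    · have hd : dep v = 1 := by omega
      have hempty : hfin.toFinset = ∅ := by
        rw [Finset.eq_empty_iff_forall_notMem]
        intro w hw
        have := (hsF w).1 hw
        rw [hC v hv hvS hvr hd hr1] at this
        exact this
      rw [hempty, Finset.sum_empty, add_zero, if_neg (by omega), if_neg (by omega), if_neg (by omega), hd]
      rcases hcv with hc | hc
      · rw [hI2 hd hr1 hc, hc, hTP0]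
      · rw [hI3 hd hr1 hc, hc, hTP0']
    · obtain ⟨m, hm⟩ : ∃ m, dep v = 2 * m + 3 := by
        obtain ⟨k, hk⟩ := hodd v hv hvS hvr hd2 hr1
        exact ⟨k - 1, by omega⟩
      obtain ⟨hlab, hcard⟩ := hP v hv hvS hvr m (cl v) hm hr1 rfl
      have hsum : ∑ w ∈ hfin.toFinset, (fun j => ({u | G.dist r u = G.dist r w + G.dist w u} ∩ F ∩ {u | SD u ∧ str j u}).ncard) =
          ∑ w ∈ hfin.toFinset, TP (s * cl v) m := by
        refine Finset.sum_congr rfl (fun w hw => ?_)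
        have hw := (hsF w).1 hw
        obtain ⟨hdw, hrw, hcw⟩ := hlab w hw
        rw [ihw w hw, if_neg (by omega), if_neg (by omega), if_neg (by omega), hcw, hdw]
        congr 1
        omega
      rw [hI4 hd2, hsum, Finset.sum_const, hcardGC, hcard, if_neg (by omega), if_neg (by omega), if_neg (by omega), hm,
        show (2 * m + 3) / 2 = m + 1 by omega, hTPs m (cl v) hcv]
  · -- rank two: `R`, `E_{m+1}`, `O_{m+1}`
    rcases Nat.lt_or_ge (dep v) 2 with hd1 | hd2
    · have hd : dep v = 1 := by omega
      obtain ⟨hlab, hcard⟩ := hR v hv hvS hvr hd hr2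
      have hsum : ∑ w ∈ hfin.toFinset, (fun j => ({u | G.dist r u = G.dist r w + G.dist w u} ∩ F ∩ {u | SD u ∧ str j u}).ncard) =
          ∑ w ∈ hfin.toFinset, (![1, 0, 0, 0, 0] : Fin 5 → ℕ) := by
        refine Finset.sum_congr rfl (fun w hw => ?_)
        have hw := (hsF w).1 hw
        rw [ihw w hw, if_pos (hlab w hw)]
      rw [hI1 hd hr2, hsum, Finset.sum_const, hcardGC, hcard, if_neg (by omega), if_pos hr2, if_neg (by rw [hd]; decide), hd,
        show 1 / 2 = 0 from rfl, hTO0]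
    · rcases Nat.even_or_odd (dep v) with heven | hodd'
      · obtain ⟨m, hm⟩ : ∃ m, dep v = 2 * m + 2 := by
          obtain ⟨k, hk⟩ := heven
          exact ⟨k - 1, by omega⟩
        obtain ⟨hlab, hcard⟩ := hE v hv hvS hvr m hm hr2
        have hsum : ∑ w ∈ hfin.toFinset, (fun j => ({u | G.dist r u = G.dist r w + G.dist w u} ∩ F ∩ {u | SD u ∧ str j u}).ncard) =
            ∑ w ∈ hfin.toFinset, TO m := by
          refine Finset.sum_congr rfl (fun w hw => ?_)
          have hw := (hsF w).1 hw
          obtain ⟨hdw, hrw⟩ := hlab w hw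
          rw [ihw w hw, if_neg (by omega), if_pos hrw, if_neg (by rw [hdw, Nat.even_add_one, Nat.even_mul]; simp), hdw,
            show (2 * m + 1) / 2 = m by omega]
        rw [hI4 hd2, hsum, Finset.sum_const, hcardGC, hcard, if_neg (by omega), if_pos hr2, if_pos heven, hm,
          show (2 * m + 2) / 2 = m + 1 by omega, hTE]
      · obtain ⟨m, hm⟩ : ∃ m, dep v = 2 * m + 3 := by
          obtain ⟨k, hk⟩ := hodd'
          exact ⟨k - 1, by omega⟩
        obtain ⟨hlab, hcE, hcP, hcM⟩ := hO v hv hvS hvr m hm hr2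
        have hsplit := (Finset.sum_filter_add_sum_filter_not hfin.toFinset (fun w => dep w = 2 * m + 2)
          (fun w => (fun j => ({u | G.dist r u = G.dist r w + G.dist w u} ∩ F ∩ {u | SD u ∧ str j u}).ncard))).symm
        have hsplit' := (Finset.sum_filter_add_sum_filter_not (hfin.toFinset.filter (fun w => ¬ dep w = 2 * m + 2)) (fun w => cl w = 1)
          (fun w => (fun j => ({u | G.dist r u = G.dist r w + G.dist w u} ∩ F ∩ {u | SD u ∧ str j u}).ncard))).symm
        have hvE : ∀ w ∈ hfin.toFinset.filter (fun w => dep w = 2 * m + 2),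
            (fun j => ({u | G.dist r u = G.dist r w + G.dist w u} ∩ F ∩ {u | SD u ∧ str j u}).ncard) = TE (m + 1) := by
          intro w hw
          rw [Finset.mem_filter] at hw
          have hw' := (hsF w).1 hw.1
          have hrw : rk w = 2 := by
            rcases hlab w hw' with ⟨-, h⟩ | ⟨h, -⟩
            · exact h
            · omega
          rw [ihw w hw', if_neg (by omega), if_pos hrw, if_pos (by rw [hw.2]; exact ⟨m + 1, by ring⟩), hw.2,
            show (2 * m + 2) / 2 = m + 1 by omega]
        have hvP : ∀ w ∈ (hfin.toFinset.filter (fun w => ¬ dep w = 2 * m + 2)).filter (fun w => cl w = 1),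
            (fun j => ({u | G.dist r u = G.dist r w + G.dist w u} ∩ F ∩ {u | SD u ∧ str j u}).ncard) = TP 1 m := by
          intro w hw
          rw [Finset.mem_filter, Finset.mem_filter] at hw
          have hw' := (hsF w).1 hw.1.1
          obtain ⟨hdw, hrw, -⟩ : dep w = 2 * m + 1 ∧ rk w = 1 ∧ (cl w = 1 ∨ cl w = -1) := by
            rcases hlab w hw' with ⟨h, -⟩ | h
            · exact absurd h hw.1.2
            · exact h
          rw [ihw w hw', if_neg (by omega), if_neg (by omega), if_neg (by omega), hw.2, hdw, show (2 * m + 1) / 2 = m by omega]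
        have hvM : ∀ w ∈ (hfin.toFinset.filter (fun w => ¬ dep w = 2 * m + 2)).filter (fun w => ¬ cl w = 1),
            (fun j => ({u | G.dist r u = G.dist r w + G.dist w u} ∩ F ∩ {u | SD u ∧ str j u}).ncard) = TP (-1) m := by
          intro w hw
          rw [Finset.mem_filter, Finset.mem_filter] at hw
          have hw' := (hsF w).1 hw.1.1
          obtain ⟨hdw, hrw, hcw⟩ : dep w = 2 * m + 1 ∧ rk w = 1 ∧ (cl w = 1 ∨ cl w = -1) := by
            rcases hlab w hw' with ⟨h, -⟩ | h
            · exact absurd h hw.1.2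
            · exact h
          have hc : cl w = -1 := hcw.resolve_left hw.2
          rw [ihw w hw', if_neg (by omega), if_neg (by omega), if_neg (by omega), hc, hdw, show (2 * m + 1) / 2 = m by omega]
        have hcE' : (hfin.toFinset.filter (fun w => dep w = 2 * m + 2)).card = q := by
          have hset : {w | w ∈ GC v ∧ dep w = 2 * m + 2} = ↑(hfin.toFinset.filter (fun w => dep w = 2 * m + 2)) := by
            ext w
            simp only [Set.mem_setOf_eq, Finset.coe_filter, Set.Finite.mem_toFinset]
          rw [← hcE, hset, Set.ncard_coe_finset]
        have hcP' : ((hfin.toFinset.filter (fun w => ¬ dep w = 2 * m + 2)).filter (fun w => cl w = 1)).card = q.choose 2 := by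
          have hset : {w | w ∈ GC v ∧ dep w = 2 * m + 1 ∧ cl w = 1} = ↑((hfin.toFinset.filter (fun w => ¬ dep w = 2 * m + 2)).filter (fun w => cl w = 1)) := by
            ext w
            simp only [Set.mem_setOf_eq, Finset.coe_filter, Finset.mem_filter, Set.Finite.mem_toFinset]
            constructor
            · rintro ⟨hw, hd, hc⟩
              exact ⟨⟨hw, by omega⟩, hc⟩
            · rintro ⟨⟨hw, hne⟩, hc⟩
              rcases hlab w hw with ⟨h, -⟩ | ⟨h, -, -⟩
              · exact absurd h hne
              · exact ⟨hw, h, hc⟩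
          rw [← hcP, hset, Set.ncard_coe_finset]
        have hcM' : ((hfin.toFinset.filter (fun w => ¬ dep w = 2 * m + 2)).filter (fun w => ¬ cl w = 1)).card = q.choose 2 := by
          have hset : {w | w ∈ GC v ∧ dep w = 2 * m + 1 ∧ cl w = -1} = ↑((hfin.toFinset.filter (fun w => ¬ dep w = 2 * m + 2)).filter (fun w => ¬ cl w = 1)) := by
            ext w
            simp only [Set.mem_setOf_eq, Finset.coe_filter, Finset.mem_filter, Set.Finite.mem_toFinset]
            constructor
            · rintro ⟨hw, hd, hc⟩
              exact ⟨⟨hw, by omega⟩, by rw [hc]; norm_num⟩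
            · rintro ⟨⟨hw, hne⟩, hc⟩
              rcases hlab w hw with ⟨h, -⟩ | ⟨h, -, hcw⟩
              · exact absurd h hne
              · exact ⟨hw, h, hcw.resolve_left hc⟩
          rw [← hcM, hset, Set.ncard_coe_finset]
        rw [hI4 hd2, hsplit, hsplit', Finset.sum_congr rfl hvE, Finset.sum_congr rfl hvP, Finset.sum_congr rfl hvM,
          Finset.sum_const, Finset.sum_const, Finset.sum_const, hcE', hcP', hcM', if_neg (by omega), if_pos hr2,
          if_neg (by rw [hm, Nat.even_add_one, Nat.even_add_one, Nat.even_add_one, Nat.even_mul]; simp), hm,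
          show (2 * m + 3) / 2 = m + 1 by omega, hTOs, smul_add]
        abel
  · -- the AXIS family (`rk v = 3`)
    have hd2 := hAdep v hv hvS hvr hr3
    rcases Nat.eq_zero_or_pos (ax v) with ha0 | hapos
    · -- boundary axis vertex `A_0`
      obtain ⟨hlab, hcE, hcP, hcM⟩ := hA0 v hv hvS hvr hr3 ha0
      have hsplit := (Finset.sum_filter_add_sum_filter_not hfin.toFinset (fun w => dep w = 2 * mA + 2)
        (fun w => (fun j => ({u | G.dist r u = G.dist r w + G.dist w u} ∩ F ∩ {u | SD u ∧ str j u}).ncard))).symm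
      have hsplit' := (Finset.sum_filter_add_sum_filter_not (hfin.toFinset.filter (fun w => ¬ dep w = 2 * mA + 2)) (fun w => cl w = 1)
        (fun w => (fun j => ({u | G.dist r u = G.dist r w + G.dist w u} ∩ F ∩ {u | SD u ∧ str j u}).ncard))).symm
      have hvE : ∀ w ∈ hfin.toFinset.filter (fun w => dep w = 2 * mA + 2),
          (fun j => ({u | G.dist r u = G.dist r w + G.dist w u} ∩ F ∩ {u | SD u ∧ str j u}).ncard) = TE (mA + 1) := by
        intro w hw
        rw [Finset.mem_filter] at hw
        have hw' := (hsF w).1 hw.1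
        have hrw : rk w = 2 := by
          rcases hlab w hw' with ⟨-, h⟩ | ⟨h, -⟩
          · exact h
          · omega
        rw [ihw w hw', if_neg (by omega), if_pos hrw, if_pos (by rw [hw.2]; exact ⟨mA + 1, by ring⟩), hw.2,
          show (2 * mA + 2) / 2 = mA + 1 by omega]
      have hvP : ∀ w ∈ (hfin.toFinset.filter (fun w => ¬ dep w = 2 * mA + 2)).filter (fun w => cl w = 1),
          (fun j => ({u | G.dist r u = G.dist r w + G.dist w u} ∩ F ∩ {u | SD u ∧ str j u}).ncard) = TP 1 mA := by
        intro w hw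
        rw [Finset.mem_filter, Finset.mem_filter] at hw
        have hw' := (hsF w).1 hw.1.1
        obtain ⟨hdw, hrw, -⟩ : dep w = 2 * mA + 1 ∧ rk w = 1 ∧ (cl w = 1 ∨ cl w = -1) := by
          rcases hlab w hw' with ⟨h, -⟩ | h
          · exact absurd h hw.1.2
          · exact h
        rw [ihw w hw', if_neg (by omega), if_neg (by omega), if_neg (by omega), hw.2, hdw, show (2 * mA + 1) / 2 = mA by omega]
      have hvM : ∀ w ∈ (hfin.toFinset.filter (fun w => ¬ dep w = 2 * mA + 2)).filter (fun w => ¬ cl w = 1),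
          (fun j => ({u | G.dist r u = G.dist r w + G.dist w u} ∩ F ∩ {u | SD u ∧ str j u}).ncard) = TP (-1) mA := by
        intro w hw
        rw [Finset.mem_filter, Finset.mem_filter] at hw
        have hw' := (hsF w).1 hw.1.1
        obtain ⟨hdw, hrw, hcw⟩ : dep w = 2 * mA + 1 ∧ rk w = 1 ∧ (cl w = 1 ∨ cl w = -1) := by
          rcases hlab w hw' with ⟨h, -⟩ | h
          · exact absurd h hw.1.2
          · exact h
        have hc : cl w = -1 := hcw.resolve_left hw.2
        rw [ihw w hw', if_neg (by omega), if_neg (by omega), if_neg (by omega), hc, hdw, show (2 * mA + 1) / 2 = mA by omega]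
      have hcE' : (hfin.toFinset.filter (fun w => dep w = 2 * mA + 2)).card = NE₀ := by
        have hset : {w | w ∈ GC v ∧ dep w = 2 * mA + 2} = ↑(hfin.toFinset.filter (fun w => dep w = 2 * mA + 2)) := by
          ext w
          simp only [Set.mem_setOf_eq, Finset.coe_filter, Set.Finite.mem_toFinset]
        rw [← hcE, hset, Set.ncard_coe_finset]
      have hcP' : ((hfin.toFinset.filter (fun w => ¬ dep w = 2 * mA + 2)).filter (fun w => cl w = 1)).card = NP₀ := by
        have hset : {w | w ∈ GC v ∧ dep w = 2 * mA + 1 ∧ cl w = 1} = ↑((hfin.toFinset.filter (fun w => ¬ dep w = 2 * mA + 2)).filter (fun w => cl w = 1)) := by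
          ext w
          simp only [Set.mem_setOf_eq, Finset.coe_filter, Finset.mem_filter, Set.Finite.mem_toFinset]
          constructor
          · rintro ⟨hw, hd, hc⟩
            exact ⟨⟨hw, by omega⟩, hc⟩
          · rintro ⟨⟨hw, hne⟩, hc⟩
            rcases hlab w hw with ⟨h, -⟩ | ⟨h, -, -⟩
            · exact absurd h hne
            · exact ⟨hw, h, hc⟩
        rw [← hcP, hset, Set.ncard_coe_finset]
      have hcM' : ((hfin.toFinset.filter (fun w => ¬ dep w = 2 * mA + 2)).filter (fun w => ¬ cl w = 1)).card = NM₀ := by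
        have hset : {w | w ∈ GC v ∧ dep w = 2 * mA + 1 ∧ cl w = -1} = ↑((hfin.toFinset.filter (fun w => ¬ dep w = 2 * mA + 2)).filter (fun w => ¬ cl w = 1)) := by
          ext w
          simp only [Set.mem_setOf_eq, Finset.coe_filter, Finset.mem_filter, Set.Finite.mem_toFinset]
          constructor
          · rintro ⟨hw, hd, hc⟩
            exact ⟨⟨hw, by omega⟩, by rw [hc]; norm_num⟩
          · rintro ⟨⟨hw, hne⟩, hc⟩
            rcases hlab w hw with ⟨h, -⟩ | ⟨h, -, hcw⟩
            · exact absurd h hne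
            · exact ⟨hw, h, hcw.resolve_left hc⟩
        rw [← hcM, hset, Set.ncard_coe_finset]
      rw [hI4 hd2, hsplit, hsplit', Finset.sum_congr rfl hvE, Finset.sum_congr rfl hvP, Finset.sum_congr rfl hvM,
        Finset.sum_const, Finset.sum_const, Finset.sum_const, hcE', hcP', hcM', if_neg (by omega), if_neg (by omega), if_pos hr3, ha0, hTA0]
      abel
    · -- interior axis vertex `A_{j+1}`
      obtain ⟨j, hj⟩ : ∃ j, ax v = j + 1 := ⟨ax v - 1, by omega⟩
      obtain ⟨hlab, hcA, hcP⟩ := hAs v hv hvS hvr hr3 j hj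
      have hsplit := (Finset.sum_filter_add_sum_filter_not hfin.toFinset (fun w => rk w = 3)
        (fun w => (fun j => ({u | G.dist r u = G.dist r w + G.dist w u} ∩ F ∩ {u | SD u ∧ str j u}).ncard))).symm
      have hvA : ∀ w ∈ hfin.toFinset.filter (fun w => rk w = 3),
          (fun j => ({u | G.dist r u = G.dist r w + G.dist w u} ∩ F ∩ {u | SD u ∧ str j u}).ncard) = TA j := by
        intro w hw
        rw [Finset.mem_filter] at hw
        have hw' := (hsF w).1 hw.1
        obtain ⟨-, haw, hdw⟩ : rk w = 3 ∧ ax w = j ∧ 1 ≤ dep w := by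
          rcases hlab w hw' with h | ⟨-, h, -⟩
          · exact h
          · omega
        rw [ihw w hw', if_neg (by omega), if_neg (by omega), if_pos hw.2, haw]
      have hvP : ∀ w ∈ hfin.toFinset.filter (fun w => ¬ rk w = 3),
          (fun j => ({u | G.dist r u = G.dist r w + G.dist w u} ∩ F ∩ {u | SD u ∧ str j u}).ncard) = TP cR mA := by
        intro w hw
        rw [Finset.mem_filter] at hw
        have hw' := (hsF w).1 hw.1
        obtain ⟨hdw, hrw, hcw⟩ : dep w = 2 * mA + 1 ∧ rk w = 1 ∧ cl w = cR := by
          rcases hlab w hw' with ⟨h, -⟩ | h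
          · exact absurd h hw.2
          · exact h
        rw [ihw w hw', if_neg (by omega), if_neg (by omega), if_neg (by omega), hcw, hdw, show (2 * mA + 1) / 2 = mA by omega]
      have hcA' : (hfin.toFinset.filter (fun w => rk w = 3)).card = qA := by
        have hset : {w | w ∈ GC v ∧ rk w = 3} = ↑(hfin.toFinset.filter (fun w => rk w = 3)) := by
          ext w
          simp only [Set.mem_setOf_eq, Finset.coe_filter, Set.Finite.mem_toFinset]
        rw [← hcA, hset, Set.ncard_coe_finset]
      have hcP' : (hfin.toFinset.filter (fun w => ¬ rk w = 3)).card = qP := by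
        have hset : {w | w ∈ GC v ∧ rk w = 1} = ↑(hfin.toFinset.filter (fun w => ¬ rk w = 3)) := by
          ext w
          simp only [Set.mem_setOf_eq, Finset.coe_filter, Set.Finite.mem_toFinset]
          constructor
          · rintro ⟨hw, hr⟩
            exact ⟨hw, by omega⟩
          · rintro ⟨hw, hne⟩
            rcases hlab w hw with ⟨h, -⟩ | ⟨-, h, -⟩
            · exact absurd h hne
            · exact ⟨hw, h⟩
        rw [← hcP, hset, Set.ncard_coe_finset]
      rw [hI4 hd2, hsplit, Finset.sum_congr rfl hvA, Finset.sum_congr rfl hvP, Finset.sum_const, Finset.sum_const, hcA', hcP',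
        if_neg (by omega), if_neg (by omega), if_pos hr3, hj, hTAs]
      abel


/-- **THE ROOT ASSEMBLY WITH THE AXIS FAMILY** (isoceles AXIS literal: `NA = 2q` axis grandchildren `A_{j₀}` and `NP ∕ NM` rank-one grandchildren of the root class; isoceles BARE
literal: `NA = NE = 0`, `(q+1)q` rank-one grandchildren of one class; the equilateral root is the case `NA = 0`): if the root `r` is fixed, self-dual, of depth `≥ 2`, and its
fixed grandchildren are `NA` axis vertices with counter `j₀`, `NE` of label `E_{m_A+1}`, `NP` of `P⁺_{m_A}`, `NM` of `P⁻_{m_A}`, then the TOTAL strata vector is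
`e₄ + NA·TA(j₀) + NE·T(E_{m_A+1}) + NP·T(P⁺_{m_A}) + NM·T(P⁻_{m_A})`. [cite: Kottwitz1986, §3] [cite: Rogawski1990, §4.9 pp. 54–56] -/
theorem strataVec_total_eq_of_localLaw_axis_of_root (hT : G.IsTree) (r : V) (F : Set V) (hFfin : F.Finite)
    (hF : ∀ w ∈ F, w ≠ r → ∀ u, G.Adj w u → G.dist r u + 1 = G.dist r w → u ∈ F) (SD : V → Prop) (str : Fin 5 → V → Prop)
    [DecidablePred (· ∈ F)] [DecidablePred SD] [∀ j, DecidablePred (str j)]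
    (hSD₁ : ∀ v c, G.Adj v c → SD v → ¬ SD c) (hSD₂ : ∀ c w, G.Adj c w → ¬ SD c → SD w)
    (dep rk ax : V → ℕ) (cl : V → ℤ)
    (hstr : ∀ w ∈ F, SD w → (str 0 w ↔ dep w = 0) ∧ (str 1 w ↔ dep w = 1 ∧ rk w = 2) ∧ (str 2 w ↔ dep w = 1 ∧ rk w = 1 ∧ cl w = 1) ∧
      (str 3 w ↔ dep w = 1 ∧ rk w = 1 ∧ cl w = -1) ∧ (str 4 w ↔ 2 ≤ dep w))
    (GC : V → Set V)
    (hGC : ∀ v w, w ∈ GC v ↔ ∃ c, (G.Adj v c ∧ G.dist r c = G.dist r v + 1 ∧ c ∈ F) ∧ (G.Adj c w ∧ G.dist r w = G.dist r c + 1 ∧ w ∈ F))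
    (q : ℕ) (s : ℤ)
    (hrk : ∀ v ∈ F, SD v → v ≠ r → 1 ≤ dep v → rk v = 1 ∨ rk v = 2 ∨ rk v = 3)
    (hcl : ∀ v ∈ F, SD v → v ≠ r → rk v = 1 → cl v = 1 ∨ cl v = -1)
    (hodd : ∀ v ∈ F, SD v → v ≠ r → 2 ≤ dep v → rk v = 1 → Odd (dep v))
    (hAdep : ∀ v ∈ F, SD v → v ≠ r → rk v = 3 → 2 ≤ dep v)
    (hB : ∀ v ∈ F, SD v → v ≠ r → dep v = 0 → GC v = ∅)
    (hC : ∀ v ∈ F, SD v → v ≠ r → dep v = 1 → rk v = 1 → GC v = ∅)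
    (hR : ∀ v ∈ F, SD v → v ≠ r → dep v = 1 → rk v = 2 → (∀ w ∈ GC v, dep w = 0) ∧ (GC v).ncard = q)
    (hE : ∀ v ∈ F, SD v → v ≠ r → ∀ m, dep v = 2 * m + 2 → rk v = 2 → (∀ w ∈ GC v, dep w = 2 * m + 1 ∧ rk w = 2) ∧ (GC v).ncard = q ^ 2)
    (hO : ∀ v ∈ F, SD v → v ≠ r → ∀ m, dep v = 2 * m + 3 → rk v = 2 →
      (∀ w ∈ GC v, (dep w = 2 * m + 2 ∧ rk w = 2) ∨ (dep w = 2 * m + 1 ∧ rk w = 1 ∧ (cl w = 1 ∨ cl w = -1))) ∧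
        {w | w ∈ GC v ∧ dep w = 2 * m + 2}.ncard = q ∧ {w | w ∈ GC v ∧ dep w = 2 * m + 1 ∧ cl w = 1}.ncard = q.choose 2 ∧
          {w | w ∈ GC v ∧ dep w = 2 * m + 1 ∧ cl w = -1}.ncard = q.choose 2)
    (hP : ∀ v ∈ F, SD v → v ≠ r → ∀ m (c : ℤ), dep v = 2 * m + 3 → rk v = 1 → cl v = c →
      (∀ w ∈ GC v, dep w = 2 * m + 1 ∧ rk w = 1 ∧ cl w = s * c) ∧ (GC v).ncard = q ^ 2)
    -- the axis family
    (mA qA qP NE₀ NP₀ NM₀ : ℕ) (cR : ℤ)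
    (hAs : ∀ v ∈ F, SD v → v ≠ r → rk v = 3 → ∀ j, ax v = j + 1 →
      (∀ w ∈ GC v, (rk w = 3 ∧ ax w = j ∧ 1 ≤ dep w) ∨ (dep w = 2 * mA + 1 ∧ rk w = 1 ∧ cl w = cR)) ∧
        {w | w ∈ GC v ∧ rk w = 3}.ncard = qA ∧ {w | w ∈ GC v ∧ rk w = 1}.ncard = qP)
    (hA0 : ∀ v ∈ F, SD v → v ≠ r → rk v = 3 → ax v = 0 →
      (∀ w ∈ GC v, (dep w = 2 * mA + 2 ∧ rk w = 2) ∨ (dep w = 2 * mA + 1 ∧ rk w = 1 ∧ (cl w = 1 ∨ cl w = -1))) ∧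
        {w | w ∈ GC v ∧ dep w = 2 * mA + 2}.ncard = NE₀ ∧ {w | w ∈ GC v ∧ dep w = 2 * mA + 1 ∧ cl w = 1}.ncard = NP₀ ∧
          {w | w ∈ GC v ∧ dep w = 2 * mA + 1 ∧ cl w = -1}.ncard = NM₀)
    (TE TO TA : ℕ → Fin 5 → ℕ) (TP : ℤ → ℕ → Fin 5 → ℕ)
    (hTE : ∀ m, TE (m + 1) = ![0, 0, 0, 0, 1] + q ^ 2 • TO m)
    (hTO0 : TO 0 = ![0, 1, 0, 0, 0] + q • ![1, 0, 0, 0, 0])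
    (hTOs : ∀ m, TO (m + 1) = ![0, 0, 0, 0, 1] + q • TE (m + 1) + q.choose 2 • (TP 1 m + TP (-1) m))
    (hTP0 : TP 1 0 = ![0, 0, 1, 0, 0]) (hTP0' : TP (-1) 0 = ![0, 0, 0, 1, 0])
    (hTPs : ∀ m (c : ℤ), c = 1 ∨ c = -1 → TP c (m + 1) = ![0, 0, 0, 0, 1] + q ^ 2 • TP (s * c) m)
    (hTA0 : TA 0 = ![0, 0, 0, 0, 1] + NE₀ • TE (mA + 1) + NP₀ • TP 1 mA + NM₀ • TP (-1) mA)
    (hTAs : ∀ j, TA (j + 1) = ![0, 0, 0, 0, 1] + qA • TA j + qP • TP cR mA)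
    (hrF : r ∈ F) (hrS : SD r) (hrdep : 2 ≤ dep r) (j₀ NA NE NP NM : ℕ)
    (hroot : (∀ w ∈ GC r, (rk w = 3 ∧ ax w = j₀ ∧ 1 ≤ dep w) ∨ (dep w = 2 * mA + 2 ∧ rk w = 2) ∨ (dep w = 2 * mA + 1 ∧ rk w = 1 ∧ (cl w = 1 ∨ cl w = -1))) ∧
      {w | w ∈ GC r ∧ rk w = 3}.ncard = NA ∧ {w | w ∈ GC r ∧ rk w = 2}.ncard = NE ∧ {w | w ∈ GC r ∧ rk w = 1 ∧ cl w = 1}.ncard = NP ∧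
        {w | w ∈ GC r ∧ rk w = 1 ∧ cl w = -1}.ncard = NM) :
    (fun j => (F ∩ {w | SD w ∧ str j w}).ncard) = ![0, 0, 0, 0, 1] + NA • TA j₀ + NE • TE (mA + 1) + NP • TP 1 mA + NM • TP (-1) mA := by
  have hcone : (fun j => (F ∩ {w | SD w ∧ str j w}).ncard) = fun j => ({w | G.dist r w = G.dist r r + G.dist r w} ∩ F ∩ {w | SD w ∧ str j w}).ncard := by
    funext j
    congr 1
    symm
    rw [Set.inter_assoc]
    exact Set.inter_eq_right.2 (fun w _ => by simp only [Set.mem_setOf_eq, SimpleGraph.dist_self, zero_add])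
  rw [hcone]
  have hGCF : GC r ⊆ F := fun w hw => by
    obtain ⟨c, -, -, -, hwF⟩ := (hGC r w).1 hw
    exact hwF
  have hGCmem : ∀ w ∈ GC r, w ∈ F ∧ SD w ∧ w ≠ r := by
    intro w hw
    obtain ⟨c, ⟨hvc, hdc, -⟩, hcw, hdw, hwF⟩ := (hGC r w).1 hw
    refine ⟨hwF, hSD₂ c w hcw (hSD₁ r c hvc hrS), ?_⟩
    rintro rfl
    rw [SimpleGraph.dist_self] at hdw
    omega
  have hfin : (GC r).Finite := hFfin.subset hGCF
  have hsF : ∀ w, w ∈ hfin.toFinset ↔ w ∈ GC r := fun w => Set.Finite.mem_toFinset _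
  rw [strataVec_cone_eq_indicator_add_sum hT r r F hFfin hF SD str (fun c hadj _ => hSD₁ r c hadj hrS) (GC r) (hGC r) hfin.toFinset hsF,
    (strataIndicator_eq_of_label (F := F) (SD := SD) (str := str) (dep := dep) (rk := rk) (cl := cl) hrF hrS (hstr r hrF hrS)).2.2.2.2 hrdep]
  have main : ∀ w ∈ GC r,
      (fun j => ({u | G.dist r u = G.dist r w + G.dist w u} ∩ F ∩ {u | SD u ∧ str j u}).ncard) =
        if dep w = 0 then ![1, 0, 0, 0, 0]
        else if rk w = 2 then (if Even (dep w) then TE (dep w / 2) else TO (dep w / 2))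
        else if rk w = 3 then TA (ax w) else TP (cl w) (dep w / 2) := by
    intro w hw
    obtain ⟨hwF, hwS, hwr⟩ := hGCmem w hw
    exact strataVec_cone_eq_of_localLaw_axis hT r F hFfin hF SD str hSD₁ hSD₂ dep rk ax cl hstr GC hGC q s hrk hcl hodd hAdep hB hC hR hE hO hP
      mA qA qP NE₀ NP₀ NM₀ cR hAs hA0 TE TO TA TP hTE hTO0 hTOs hTP0 hTP0' hTPs hTA0 hTAs hwF hwS hwr
  obtain ⟨hlab, hcA, hcE, hcP, hcM⟩ := hroot
  -- split the grandchildren: axis | rank two | rank one (+) | rank one (−)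
  have hsplit := (Finset.sum_filter_add_sum_filter_not hfin.toFinset (fun w => rk w = 3)
    (fun w => (fun j => ({u | G.dist r u = G.dist r w + G.dist w u} ∩ F ∩ {u | SD u ∧ str j u}).ncard))).symm
  have hsplit' := (Finset.sum_filter_add_sum_filter_not (hfin.toFinset.filter (fun w => ¬ rk w = 3)) (fun w => rk w = 2)
    (fun w => (fun j => ({u | G.dist r u = G.dist r w + G.dist w u} ∩ F ∩ {u | SD u ∧ str j u}).ncard))).symm
  have hsplit'' := (Finset.sum_filter_add_sum_filter_not ((hfin.toFinset.filter (fun w => ¬ rk w = 3)).filter (fun w => ¬ rk w = 2)) (fun w => cl w = 1)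
    (fun w => (fun j => ({u | G.dist r u = G.dist r w + G.dist w u} ∩ F ∩ {u | SD u ∧ str j u}).ncard))).symm
  have hvA : ∀ w ∈ hfin.toFinset.filter (fun w => rk w = 3),
      (fun j => ({u | G.dist r u = G.dist r w + G.dist w u} ∩ F ∩ {u | SD u ∧ str j u}).ncard) = TA j₀ := by
    intro w hw
    rw [Finset.mem_filter] at hw
    have hw' := (hsF w).1 hw.1
    obtain ⟨-, haw, hdw⟩ : rk w = 3 ∧ ax w = j₀ ∧ 1 ≤ dep w := by
      rcases hlab w hw' with h | ⟨-, h⟩ | ⟨-, h, -⟩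
      · exact h
      · omega
      · omega
    rw [main w hw', if_neg (by omega), if_neg (by omega), if_pos hw.2, haw]
  have hvE : ∀ w ∈ (hfin.toFinset.filter (fun w => ¬ rk w = 3)).filter (fun w => rk w = 2),
      (fun j => ({u | G.dist r u = G.dist r w + G.dist w u} ∩ F ∩ {u | SD u ∧ str j u}).ncard) = TE (mA + 1) := by
    intro w hw
    rw [Finset.mem_filter, Finset.mem_filter] at hw
    have hw' := (hsF w).1 hw.1.1
    have hdw : dep w = 2 * mA + 2 := by
      rcases hlab w hw' with ⟨h, -⟩ | ⟨h, -⟩ | ⟨-, h, -⟩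
      · exact absurd h hw.1.2
      · exact h
      · omega
    rw [main w hw', if_neg (by omega), if_pos hw.2, if_pos (by rw [hdw]; exact ⟨mA + 1, by ring⟩), hdw, show (2 * mA + 2) / 2 = mA + 1 by omega]
  have hvP : ∀ w ∈ ((hfin.toFinset.filter (fun w => ¬ rk w = 3)).filter (fun w => ¬ rk w = 2)).filter (fun w => cl w = 1),
      (fun j => ({u | G.dist r u = G.dist r w + G.dist w u} ∩ F ∩ {u | SD u ∧ str j u}).ncard) = TP 1 mA := by
    intro w hw
    rw [Finset.mem_filter, Finset.mem_filter, Finset.mem_filter] at hw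
    have hw' := (hsF w).1 hw.1.1.1
    obtain ⟨hdw, hrw, -⟩ : dep w = 2 * mA + 1 ∧ rk w = 1 ∧ (cl w = 1 ∨ cl w = -1) := by
      rcases hlab w hw' with ⟨h, -⟩ | ⟨-, h⟩ | h
      · exact absurd h hw.1.1.2
      · exact absurd h hw.1.2
      · exact h
    rw [main w hw', if_neg (by omega), if_neg (by omega), if_neg (by omega), hw.2, hdw, show (2 * mA + 1) / 2 = mA by omega]
  have hvM : ∀ w ∈ ((hfin.toFinset.filter (fun w => ¬ rk w = 3)).filter (fun w => ¬ rk w = 2)).filter (fun w => ¬ cl w = 1),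
      (fun j => ({u | G.dist r u = G.dist r w + G.dist w u} ∩ F ∩ {u | SD u ∧ str j u}).ncard) = TP (-1) mA := by
    intro w hw
    rw [Finset.mem_filter, Finset.mem_filter, Finset.mem_filter] at hw
    have hw' := (hsF w).1 hw.1.1.1
    obtain ⟨hdw, hrw, hcw⟩ : dep w = 2 * mA + 1 ∧ rk w = 1 ∧ (cl w = 1 ∨ cl w = -1) := by
      rcases hlab w hw' with ⟨h, -⟩ | ⟨-, h⟩ | h
      · exact absurd h hw.1.1.2
      · exact absurd h hw.1.2
      · exact h
    have hc : cl w = -1 := hcw.resolve_left hw.2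
    rw [main w hw', if_neg (by omega), if_neg (by omega), if_neg (by omega), hc, hdw, show (2 * mA + 1) / 2 = mA by omega]
  have hcA' : (hfin.toFinset.filter (fun w => rk w = 3)).card = NA := by
    have hset : {w | w ∈ GC r ∧ rk w = 3} = ↑(hfin.toFinset.filter (fun w => rk w = 3)) := by
      ext w
      simp only [Set.mem_setOf_eq, Finset.coe_filter, Set.Finite.mem_toFinset]
    rw [← hcA, hset, Set.ncard_coe_finset]
  have hcE' : ((hfin.toFinset.filter (fun w => ¬ rk w = 3)).filter (fun w => rk w = 2)).card = NE := by
    have hset : {w | w ∈ GC r ∧ rk w = 2} = ↑((hfin.toFinset.filter (fun w => ¬ rk w = 3)).filter (fun w => rk w = 2)) := by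
      ext w
      simp only [Set.mem_setOf_eq, Finset.coe_filter, Finset.mem_filter, Set.Finite.mem_toFinset]
      constructor
      · rintro ⟨hw, hr⟩
        exact ⟨⟨hw, by omega⟩, hr⟩
      · rintro ⟨⟨hw, -⟩, hr⟩
        exact ⟨hw, hr⟩
    rw [← hcE, hset, Set.ncard_coe_finset]
  have hcP' : (((hfin.toFinset.filter (fun w => ¬ rk w = 3)).filter (fun w => ¬ rk w = 2)).filter (fun w => cl w = 1)).card = NP := by
    have hset : {w | w ∈ GC r ∧ rk w = 1 ∧ cl w = 1} =
        ↑(((hfin.toFinset.filter (fun w => ¬ rk w = 3)).filter (fun w => ¬ rk w = 2)).filter (fun w => cl w = 1)) := by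
      ext w
      simp only [Set.mem_setOf_eq, Finset.coe_filter, Finset.mem_filter, Set.Finite.mem_toFinset]
      constructor
      · rintro ⟨hw, hr, hc⟩
        exact ⟨⟨⟨hw, by omega⟩, by omega⟩, hc⟩
      · rintro ⟨⟨⟨hw, h3⟩, h2⟩, hc⟩
        rcases hlab w hw with ⟨h, -⟩ | ⟨-, h⟩ | ⟨-, h, -⟩
        · exact absurd h h3
        · exact absurd h h2
        · exact ⟨hw, h, hc⟩
    rw [← hcP, hset, Set.ncard_coe_finset]
  have hcM' : (((hfin.toFinset.filter (fun w => ¬ rk w = 3)).filter (fun w => ¬ rk w = 2)).filter (fun w => ¬ cl w = 1)).card = NM := by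
    have hset : {w | w ∈ GC r ∧ rk w = 1 ∧ cl w = -1} =
        ↑(((hfin.toFinset.filter (fun w => ¬ rk w = 3)).filter (fun w => ¬ rk w = 2)).filter (fun w => ¬ cl w = 1)) := by
      ext w
      simp only [Set.mem_setOf_eq, Finset.coe_filter, Finset.mem_filter, Set.Finite.mem_toFinset]
      constructor
      · rintro ⟨hw, hr, hc⟩
        exact ⟨⟨⟨hw, by omega⟩, by omega⟩, by rw [hc]; norm_num⟩
      · rintro ⟨⟨⟨hw, h3⟩, h2⟩, hc⟩
        rcases hlab w hw with ⟨h, -⟩ | ⟨-, h⟩ | ⟨-, h, hcw⟩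
        · exact absurd h h3
        · exact absurd h h2
        · exact ⟨hw, h, hcw.resolve_left hc⟩
    rw [← hcM, hset, Set.ncard_coe_finset]
  rw [hsplit, hsplit', hsplit'', Finset.sum_congr rfl hvA, Finset.sum_congr rfl hvE, Finset.sum_congr rfl hvP, Finset.sum_congr rfl hvM,
    Finset.sum_const, Finset.sum_const, Finset.sum_const, Finset.sum_const, hcA', hcE', hcP', hcM']
  abel

end Literature.NumberTheory.Rogawski1990
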